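import Literature.Probability.LatticeModels.DobrushinMetricStates
import HarnessLib

/-!
# Dobrushin's comparison, uniqueness and covariance estimates in the Vasserstein form for
INFINITE-RANGE one-site laws with summable rows

Fourth file of the Vasserstein (Kantorovich–Rubinstein) form of Dobrushin's contraction technique.
The landed files (`DobrushinComparisonMetric.lean`, `DobrushinMetricStates.lean`,
`DobrushinMetricWeightedDecay.lean`) encode Dobrushin's condition as `IsKRContraction γ r nbr C`
with a FINITE set `nbr x` through which the one-site law at `x` reads the boundary condition, so
that the averaging operators `T_x` preserve LOCAL observables and all sums are finite. The printed
sources carry no such restriction: Föllmer (LNM 1362, Ch. I, (2.6)–(2.9), (2.13), (2.20)–(2.23))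
works with an arbitrary countable index set `I` and the infinite matrix `C = (C_{ik})`, condition
`c = sup_k ∑_i C_{ik} < 1`, and the test class `L(Ω)` of functions with
`|f(ω) - f(η)| ≤ ∑_i r(ω(i), η(i)) δ_i(f)`, `∑_i δ_i(f) < ∞`; Friedli–Velenik (2017, Thm. 6.31) state
Dobrushin's uniqueness theorem for a quasilocal specification with `c(π) = sup_i ∑_j c_{ij}(π) < 1`,
the sum running over ALL sites. This file proves that generality (needed e.g. for Gibbsian
specifications of absolutely summable, infinite-range interactions):

* the abstract layer with SUMMABLE Lipschitz vectors and `∑'`-rows (Föllmer's Lemma (2.5) with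
  his own proof device: the finite sweeps `a^J` and a tail estimate, `est_phi_tsum`; the iterates
  `≤ R cⁿ`, and `≤ R (cⁿ + θ)` under the weighted row-sum condition of Cor. (2.14) /
  Georgii Rem. 8.26);
* the measure theory for a general specification `γ` whose one-site laws satisfy the GLOBAL
  Kantorovich–Rubinstein bound `R(γ_x(·|ω), γ_x(·|η)) ≤ ∑' y, C x y · r(ω y, η y)` for all `ω, η`
  with summable rows `∑' y, C x y ≤ c` (hypotheses `hCs`, `hcontr`, `hrow` — no `Finset` of
  neighbours; `IsKRContraction.global` / `IsKRContraction.summable_indicator` derive them from the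
  finite-range `IsKRContraction`, so the results below contain those of
  `DobrushinMetricStates.lean`; `global_of_sitewise_of_quasilocal` derives the global bound from
  SITEWISE coefficients plus quasilocality of the one-site law, Föllmer's (2.20) with (2.4)): the
  dusting lemma `lip_siteAvg_tsum`, invariant states (Gibbs
  measures, tilts), **uniqueness** `subsingleton_gibbsMeasures_of_summable` (Föllmer (2.9);
  Friedli–Velenik Thm. 6.31; Georgii Thm. 8.7), its total-variation form
  `subsingleton_gibbsMeasures_of_summable_tv` (Friedli–Velenik Thm. 6.31 as printed, discrete
  weight) and the **weighted covariance estimates**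
  `abs_covariance_le_of_summable_weighted` / `_exp_profile` / `_exp_dist` (Föllmer (2.13)/(2.23)
  with Cor. (2.14)/(2.24); Georgii Remark 8.26; Künsch 1982).

Theorems only: no definition, no named fact. The weight `r` is assumed to vanish on the diagonal
(`r a a = 0`, any pseudo-metric), which the global Lipschitz class needs.

## References

* H. Föllmer, *Random fields and diffusion processes*, École d'Été de Probabilités de Saint-Flour
  XV–XVII, LNM 1362 (1988), Ch. I §2: (2.3)–(2.9), Thm. (2.13), Cor. (2.14), Remark (2.17) with
  (2.18)–(2.24).
* S. Friedli, Y. Velenik, *Statistical Mechanics of Lattice Systems* (CUP 2017), §6.5.2: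
  Thm. 6.31, Lemma 6.32, Prop. 6.33, Lemma 6.34 (pp. 288–291).
* H.-O. Georgii, *Gibbs Measures and Phase Transitions*, 2nd ed. (2011), Thm. 8.7, Thm. 8.20,
  Remark 8.26.
* R. L. Dobrushin, Theory Probab. Appl. 15 (1970) 458–486, Thm. 3–4.
-/

noncomputable section

open MeasureTheory ProbabilityTheory Finset Function Filter
open scoped Topology

namespace Literature.Probability.LatticeModels

namespace DobrushinMetric

/-! ### The abstract layer with summable Lipschitz vectors -/

section Abstract

variable {ι Ω : Type*} [DecidableEq ι]
variable {R B : ℝ} {Adm : (Ω → ℝ) → Prop} {Lip : (Ω → ℝ) → (ι → ℝ) → Prop}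
  {T : ι → (Ω → ℝ) → (Ω → ℝ)} {C : ι → ι → ℝ} {W : Set ι} {E₁ E₂ : (Ω → ℝ) → ℝ}

omit [DecidableEq ι] in
/-- A nonnegative vector bounded by `B`, multiplied by a nonnegative summable vector, is summable.
[folklore] -/
private theorem summable_mul_of_bdd {a δ : ι → ℝ} (ha0 : ∀ y, 0 ≤ a y) (haB : ∀ y, a y ≤ B)
    (hδ0 : ∀ y, 0 ≤ δ y) (hδs : Summable δ) : Summable fun y => a y * δ y :=
  Summable.of_nonneg_of_le (fun y => mul_nonneg (ha0 y) (hδ0 y))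
    (fun y => mul_le_mul_of_nonneg_right (haB y) (hδ0 y)) (hδs.mul_left B)

omit [DecidableEq ι] in
/-- A nonnegative summable row, multiplied by a nonnegative vector bounded by `B`, is summable.
[folklore] -/
private theorem summable_row_mul_of_bdd {c a : ι → ℝ} (hc0 : ∀ y, 0 ≤ c y) (hcs : Summable c)
    (ha0 : ∀ y, 0 ≤ a y) (haB : ∀ y, a y ≤ B) : Summable fun y => c y * a y :=
  Summable.of_nonneg_of_le (fun y => mul_nonneg (hc0 y) (ha0 y))
    (fun y => mul_le_mul_of_nonneg_left (haB y) (hc0 y)) (hcs.mul_right B)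

omit [DecidableEq ι] in
/-- **The constant vector `R` is an estimate** (Föllmer 1988, Ch. I, after (2.3) and (2.22): a
uniformly bounded estimate "to start the argument in (2.5)"), for two monotone-normalised
functionals and observables whose Lipschitz vector `δ` controls the total oscillation,
`|F σ - F τ| ≤ R ∑' δ`. [cite: Follmer1988, Ch. I (2.22)] -/
theorem est_const_tsum
    (hosc : ∀ ⦃F : Ω → ℝ⦄ ⦃δ : ι → ℝ⦄, Adm F → Lip F δ → ∀ σ τ, |F σ - F τ| ≤ R * ∑' y, δ y)
    (h₁le : ∀ ⦃F : Ω → ℝ⦄ ⦃M : ℝ⦄, Adm F → (∀ σ, F σ ≤ M) → E₁ F ≤ M)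
    (h₁ge : ∀ ⦃F : Ω → ℝ⦄ ⦃M : ℝ⦄, Adm F → (∀ σ, M ≤ F σ) → M ≤ E₁ F)
    (h₂le : ∀ ⦃F : Ω → ℝ⦄ ⦃M : ℝ⦄, Adm F → (∀ σ, F σ ≤ M) → E₂ F ≤ M)
    (h₂ge : ∀ ⦃F : Ω → ℝ⦄ ⦃M : ℝ⦄, Adm F → (∀ σ, M ≤ F σ) → M ≤ E₂ F)
    ⦃F : Ω → ℝ⦄ ⦃δ : ι → ℝ⦄ (hF : Adm F) (hδ : Lip F δ) :
    |E₁ F - E₂ F| ≤ ∑' y, R * δ y := by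
  rw [tsum_mul_left]
  set S := R * ∑' y, δ y
  have hB : ∀ σ τ, F σ ≤ F τ + S := fun σ τ => by
    have h := hosc hF hδ σ τ
    linarith [(abs_le.1 h).2]
  have h12 : E₁ F ≤ E₂ F + S := h₁le hF fun σ => by
    have : F σ - S ≤ E₂ F := h₂ge hF fun τ => by linarith [hB σ τ]
    linarith
  have h21 : E₂ F ≤ E₁ F + S := h₂le hF fun σ => by
    have : F σ - S ≤ E₁ F := h₁ge hF fun τ => by linarith [hB σ τ]
    linarith
  rw [abs_le]
  constructor <;> linarith

/-- **Dusting step with summable rows** (Föllmer 1988, Ch. I, proof of Lemma (2.5): apply the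
estimate to `π_k f` and use `δ_i(π_k f) ≤ δ_i(f) + C_{ik} δ_k(f)`, `δ_k(π_k f) = 0`): if the bounded
nonnegative vector `a` is an estimate and `x` is usable, then replacing `a x` by the row
`∑' y, C x y · a y` gives an estimate. [cite: Follmer1988, Ch. I Lemma (2.5)] -/
theorem est_update_tsum (hlip0 : ∀ ⦃F : Ω → ℝ⦄ ⦃δ : ι → ℝ⦄, Lip F δ → ∀ y, 0 ≤ δ y)
    (hlips : ∀ ⦃F : Ω → ℝ⦄ ⦃δ : ι → ℝ⦄, Lip F δ → Summable δ)
    (hC0 : ∀ x y, 0 ≤ C x y) (hCs : ∀ x, Summable (C x))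
    (hT : ∀ ⦃F : Ω → ℝ⦄ (x : ι), Adm F → Adm (T x F))
    (hdust : ∀ ⦃F : Ω → ℝ⦄ ⦃δ : ι → ℝ⦄ (x : ι), Adm F → Lip F δ →
      Lip (T x F) fun y => if y = x then 0 else δ y + C x y * δ x)
    (h₁T : ∀ ⦃F : Ω → ℝ⦄ (x : ι), x ∈ W → Adm F → E₁ (T x F) = E₁ F)
    (h₂T : ∀ ⦃F : Ω → ℝ⦄ (x : ι), x ∈ W → Adm F → E₂ (T x F) = E₂ F)
    {a : ι → ℝ} (ha : ∀ ⦃F : Ω → ℝ⦄ ⦃δ : ι → ℝ⦄, Adm F → Lip F δ → |E₁ F - E₂ F| ≤ ∑' y, a y * δ y)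
    (ha0 : ∀ y, 0 ≤ a y) (haB : ∀ y, a y ≤ B) {x : ι} (hx : x ∈ W)
    ⦃F : Ω → ℝ⦄ ⦃δ : ι → ℝ⦄ (hF : Adm F) (hδ : Lip F δ) :
    |E₁ F - E₂ F| ≤ ∑' y, Function.update a x (∑' z, C x z * a z) y * δ y := by
  have hδ0 := hlip0 hδ
  have hδs := hlips hδ
  have hδ' := hdust x hF hδ
  have key := ha (hT x hF) hδ'
  rw [h₁T x hx hF, h₂T x hx hF] at key
  refine key.trans ?_
  -- summability bookkeeping
  set v : ℝ := ∑' z, C x z * a z with hv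
  have hs1 : Summable fun y => a y * δ y := summable_mul_of_bdd ha0 haB hδ0 hδs
  have hs2 : Summable fun y => C x y * a y := summable_row_mul_of_bdd (hC0 x) (hCs x) ha0 haB
  have hv0 : 0 ≤ v := tsum_nonneg fun z => mul_nonneg (hC0 x z) (ha0 z)
  have hs3 : Summable fun y => if y = x then (0 : ℝ) else a y * δ y :=
    Summable.of_nonneg_of_le
      (fun y => by split_ifs; exacts [le_rfl, mul_nonneg (ha0 y) (hδ0 y)])
      (fun y => by split_ifs; exacts [mul_nonneg (ha0 y) (hδ0 y), le_rfl]) hs1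
  have hs4 : Summable fun y => if y = x then (0 : ℝ) else C x y * a y :=
    Summable.of_nonneg_of_le
      (fun y => by split_ifs; exacts [le_rfl, mul_nonneg (hC0 x y) (ha0 y)])
      (fun y => by split_ifs; exacts [mul_nonneg (hC0 x y) (ha0 y), le_rfl]) hs2
  have hu0 : ∀ y, 0 ≤ Function.update a x v y := fun y => by
    rcases eq_or_ne y x with rfl | hne
    · rw [Function.update_self]; exact hv0
    · rw [Function.update_of_ne hne]; exact ha0 y
  have huB : ∀ y, Function.update a x v y ≤ max B v := fun y => by
    rcases eq_or_ne y x with rfl | hne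
    · rw [Function.update_self]; exact le_max_right _ _
    · rw [Function.update_of_ne hne]; exact (haB y).trans (le_max_left _ _)
  have hs5 : Summable fun y => Function.update a x v y * δ y := summable_mul_of_bdd hu0 huB hδ0 hδs
  -- termwise splitting of the dusted estimate
  have hsplit : ∀ y, a y * (if y = x then 0 else δ y + C x y * δ x) =
      (if y = x then 0 else a y * δ y) + δ x * (if y = x then 0 else C x y * a y) := fun y => by
    split_ifs <;> ring
  have hite : ∑' y, (if y = x then (0 : ℝ) else C x y * a y) ≤ v :=
    hs4.tsum_le_tsum (fun y => by split_ifs; exacts [mul_nonneg (hC0 x y) (ha0 y), le_rfl]) hs2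
  -- the updated vector, summed against `δ`
  have hupd : ∑' y, Function.update a x v y * δ y =
      (∑' y, if y = x then (0 : ℝ) else a y * δ y) + v * δ x := by
    rw [hs5.tsum_eq_add_tsum_ite x, Function.update_self, add_comm]
    congr 1
    refine tsum_congr fun y => ?_
    rcases eq_or_ne y x with rfl | hne
    · simp
    · rw [if_neg hne, if_neg hne, Function.update_of_ne hne]
  calc ∑' y, a y * (if y = x then 0 else δ y + C x y * δ x)
      = ∑' y, ((if y = x then 0 else a y * δ y) + δ x * (if y = x then 0 else C x y * a y)) :=
        tsum_congr hsplit
    _ = (∑' y, if y = x then (0 : ℝ) else a y * δ y) +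
          δ x * ∑' y, (if y = x then (0 : ℝ) else C x y * a y) := by
        rw [hs3.tsum_add (hs4.mul_left (δ x)), tsum_mul_left]
    _ ≤ (∑' y, if y = x then (0 : ℝ) else a y * δ y) + δ x * v := by
        have := mul_le_mul_of_nonneg_left hite (hδ0 x)
        linarith
    _ = ∑' y, Function.update a x v y * δ y := by rw [hupd, mul_comm]

/-- Dusting step, monotone form (Föllmer 1988, Ch. I, proof of Lemma (2.5): the vectors `a^J`
with `a^J_i = min(a_i, (aC + b)_i)`): replacing `a x` by `min (a x) (∑' z, C x z · a z)` gives an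
estimate. [cite: Follmer1988, Ch. I Lemma (2.5)] -/
theorem est_update_min_tsum (hlip0 : ∀ ⦃F : Ω → ℝ⦄ ⦃δ : ι → ℝ⦄, Lip F δ → ∀ y, 0 ≤ δ y)
    (hlips : ∀ ⦃F : Ω → ℝ⦄ ⦃δ : ι → ℝ⦄, Lip F δ → Summable δ)
    (hC0 : ∀ x y, 0 ≤ C x y) (hCs : ∀ x, Summable (C x))
    (hT : ∀ ⦃F : Ω → ℝ⦄ (x : ι), Adm F → Adm (T x F))
    (hdust : ∀ ⦃F : Ω → ℝ⦄ ⦃δ : ι → ℝ⦄ (x : ι), Adm F → Lip F δ →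
      Lip (T x F) fun y => if y = x then 0 else δ y + C x y * δ x)
    (h₁T : ∀ ⦃F : Ω → ℝ⦄ (x : ι), x ∈ W → Adm F → E₁ (T x F) = E₁ F)
    (h₂T : ∀ ⦃F : Ω → ℝ⦄ (x : ι), x ∈ W → Adm F → E₂ (T x F) = E₂ F)
    {a : ι → ℝ} (ha : ∀ ⦃F : Ω → ℝ⦄ ⦃δ : ι → ℝ⦄, Adm F → Lip F δ → |E₁ F - E₂ F| ≤ ∑' y, a y * δ y)
    (ha0 : ∀ y, 0 ≤ a y) (haB : ∀ y, a y ≤ B) {x : ι} (hx : x ∈ W)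
    ⦃F : Ω → ℝ⦄ ⦃δ : ι → ℝ⦄ (hF : Adm F) (hδ : Lip F δ) :
    |E₁ F - E₂ F| ≤ ∑' y, Function.update a x (min (a x) (∑' z, C x z * a z)) y * δ y := by
  rcases le_total (a x) (∑' z, C x z * a z) with h | h
  · rw [min_eq_left h, Function.update_eq_self]
    exact ha hF hδ
  · rw [min_eq_right h]
    exact est_update_tsum hlip0 hlips hC0 hCs hT hdust h₁T h₂T ha ha0 haB hx hF hδ

/-- The tail `∑'_{y ∉ s} δ y` of a nonnegative summable vector tends to `0` along the finite sets
`s`. [folklore] -/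
private theorem tendsto_tsum_ite_compl {δ : ι → ℝ} (hδ0 : ∀ y, 0 ≤ δ y) (hδs : Summable δ) :
    Tendsto (fun s : Finset ι => ∑' y, if y ∈ s then (0 : ℝ) else δ y) atTop (𝓝 0) := by
  have hdecomp : ∀ s : Finset ι,
      (∑' y, if y ∈ s then (0 : ℝ) else δ y) = (∑' y, δ y) - ∑ y ∈ s, δ y := fun s => by
    have hs_in : Summable fun y => if y ∈ s then δ y else (0 : ℝ) :=
      Summable.of_nonneg_of_le (fun y => by split_ifs; exacts [hδ0 y, le_rfl])
        (fun y => by split_ifs; exacts [le_rfl, hδ0 y]) hδs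
    have hs_out : Summable fun y => if y ∈ s then (0 : ℝ) else δ y :=
      Summable.of_nonneg_of_le (fun y => by split_ifs; exacts [le_rfl, hδ0 y])
        (fun y => by split_ifs; exacts [hδ0 y, le_rfl]) hδs
    have hsum : (∑' y, δ y) = (∑' y, if y ∈ s then δ y else (0 : ℝ)) +
        ∑' y, if y ∈ s then (0 : ℝ) else δ y := by
      rw [← hs_in.tsum_add hs_out]
      exact tsum_congr fun y => by split_ifs <;> simp
    have hfin : (∑' y, if y ∈ s then δ y else (0 : ℝ)) = ∑ y ∈ s, δ y := by
      rw [tsum_eq_sum (s := s) (fun y hy => if_neg hy)]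
      exact Finset.sum_congr rfl fun y hy => if_pos hy
    rw [hsum, hfin]
    ring
  simp_rw [hdecomp]
  have hlim : Tendsto (fun s : Finset ι => ∑ y ∈ s, δ y) atTop (𝓝 (∑' y, δ y)) := by
    have h := hδs.hasSum
    rwa [HasSum, SummationFilter.unconditional_filter] at h
  have := (tendsto_const_nhds (x := ∑' y, δ y)).sub hlim
  simpa using this

/-- **Lemma (2.5) of Föllmer, vector form with summable rows and summable Lipschitz vectors**:
if the bounded nonnegative vector `a` is an estimate, then so is its simultaneous update
`Φ a = (∑' z, C · z a z)` on the usable sites (`a` elsewhere) — Föllmer's own device: for every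
finite `J` the vector `a^J = min(a, Φ a)` on `J` (and `a` off `J`) is an estimate by finitely many
dusting steps; the tail `∑'_{y ∉ J} a y δ y ≤ B ∑'_{y ∉ J} δ y` tends to zero.
[cite: Follmer1988, Ch. I Lemma (2.5)] -/
theorem est_phi_tsum [DecidablePred (· ∈ W)]
    (hlip0 : ∀ ⦃F : Ω → ℝ⦄ ⦃δ : ι → ℝ⦄, Lip F δ → ∀ y, 0 ≤ δ y)
    (hlips : ∀ ⦃F : Ω → ℝ⦄ ⦃δ : ι → ℝ⦄, Lip F δ → Summable δ)
    (hC0 : ∀ x y, 0 ≤ C x y) (hCs : ∀ x, Summable (C x))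
    (hT : ∀ ⦃F : Ω → ℝ⦄ (x : ι), Adm F → Adm (T x F))
    (hdust : ∀ ⦃F : Ω → ℝ⦄ ⦃δ : ι → ℝ⦄ (x : ι), Adm F → Lip F δ →
      Lip (T x F) fun y => if y = x then 0 else δ y + C x y * δ x)
    (h₁T : ∀ ⦃F : Ω → ℝ⦄ (x : ι), x ∈ W → Adm F → E₁ (T x F) = E₁ F)
    (h₂T : ∀ ⦃F : Ω → ℝ⦄ (x : ι), x ∈ W → Adm F → E₂ (T x F) = E₂ F)
    {phi : (ι → ℝ) → ι → ℝ} (hphi : ∀ a y, phi a y = if y ∈ W then ∑' z, C y z * a z else a y)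
    {a : ι → ℝ} (ha : ∀ ⦃F : Ω → ℝ⦄ ⦃δ : ι → ℝ⦄, Adm F → Lip F δ → |E₁ F - E₂ F| ≤ ∑' y, a y * δ y)
    (ha0 : ∀ y, 0 ≤ a y) (haB : ∀ y, a y ≤ B) (hphiB : ∀ y, phi a y ≤ B)
    ⦃F : Ω → ℝ⦄ ⦃δ : ι → ℝ⦄ (hF : Adm F) (hδ : Lip F δ) :
    |E₁ F - E₂ F| ≤ ∑' y, phi a y * δ y := by
  have hδ0 := hlip0 hδ
  have hδs := hlips hδ
  have hphi0 : ∀ y, 0 ≤ phi a y := fun y => by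
    rw [hphi]
    split_ifs
    · exact tsum_nonneg fun z => mul_nonneg (hC0 y z) (ha0 z)
    · exact ha0 y
  -- finite sweeps
  have sweep : ∀ s : Finset ι, ∃ b : ι → ℝ,
      (∀ ⦃F : Ω → ℝ⦄ ⦃δ : ι → ℝ⦄, Adm F → Lip F δ → |E₁ F - E₂ F| ≤ ∑' y, b y * δ y) ∧
      (∀ y, 0 ≤ b y) ∧ (∀ y, b y ≤ a y) ∧ ∀ y ∈ s, y ∈ W → b y ≤ ∑' z, C y z * a z := by
    intro s
    induction s using Finset.induction_on with
    | empty => exact ⟨a, ha, ha0, fun _ => le_rfl, fun _ h => (Finset.notMem_empty _ h).elim⟩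
    | insert x s _ ih =>
      obtain ⟨b, hb, hb0, hba, hbs⟩ := ih
      by_cases hx : x ∈ W
      · have hbB : ∀ y, b y ≤ B := fun y => (hba y).trans (haB y)
        refine ⟨Function.update b x (min (b x) (∑' z, C x z * b z)),
          est_update_min_tsum hlip0 hlips hC0 hCs hT hdust h₁T h₂T hb hb0 hbB hx,
          fun y => ?_, fun y => ?_, fun y hy hyW => ?_⟩
        · rcases eq_or_ne y x with rfl | hne
          · rw [Function.update_self]
            exact le_min (hb0 _) (tsum_nonneg fun z => mul_nonneg (hC0 y z) (hb0 z))
          · rw [Function.update_of_ne hne]; exact hb0 y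
        · rcases eq_or_ne y x with rfl | hne
          · rw [Function.update_self]; exact (min_le_left _ _).trans (hba _)
          · rw [Function.update_of_ne hne]; exact hba y
        · rcases eq_or_ne y x with rfl | hne
          · rw [Function.update_self]
            refine (min_le_right _ _).trans ?_
            exact (summable_row_mul_of_bdd (hC0 y) (hCs y) hb0 hbB).tsum_le_tsum
              (fun z => mul_le_mul_of_nonneg_left (hba z) (hC0 y z))
              (summable_row_mul_of_bdd (hC0 y) (hCs y) ha0 haB)
          · rw [Function.update_of_ne hne]
            exact hbs y ((Finset.mem_insert.1 hy).resolve_left hne) hyW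
      · refine ⟨b, hb, hb0, hba, fun y hy hyW => ?_⟩
        rcases eq_or_ne y x with rfl | hne
        · exact (hx hyW).elim
        · exact hbs y ((Finset.mem_insert.1 hy).resolve_left hne) hyW
  -- the estimate of every sweep, bounded by `Φ a` plus a tail
  have hs_phi : Summable fun y => phi a y * δ y := summable_mul_of_bdd hphi0 hphiB hδ0 hδs
  have htail : ∀ s : Finset ι, |E₁ F - E₂ F| ≤
      (∑' y, phi a y * δ y) + B * ∑' y, (if y ∈ s then (0 : ℝ) else δ y) := fun s => by
    obtain ⟨b, hb, hb0, hba, hbs⟩ := sweep s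
    have hs_b : Summable fun y => b y * δ y :=
      summable_mul_of_bdd hb0 (fun y => (hba y).trans (haB y)) hδ0 hδs
    have hs_t : Summable fun y => if y ∈ s then (0 : ℝ) else δ y :=
      Summable.of_nonneg_of_le (fun y => by split_ifs; exacts [le_rfl, hδ0 y])
        (fun y => by split_ifs; exacts [hδ0 y, le_rfl]) hδs
    refine (hb hF hδ).trans ?_
    rw [← tsum_mul_left, ← hs_phi.tsum_add (hs_t.mul_left B)]
    refine hs_b.tsum_le_tsum (fun y => ?_) (hs_phi.add (hs_t.mul_left B))
    by_cases hys : y ∈ s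
    · rw [if_pos hys, mul_zero, add_zero]
      refine mul_le_mul_of_nonneg_right ?_ (hδ0 y)
      by_cases hyW : y ∈ W
      · rw [hphi, if_pos hyW]; exact hbs y hys hyW
      · rw [hphi, if_neg hyW]; exact hba y
    · rw [if_neg hys]
      have h1 : b y * δ y ≤ B * δ y :=
        mul_le_mul_of_nonneg_right ((hba y).trans (haB y)) (hδ0 y)
      have h2 : 0 ≤ phi a y * δ y := mul_nonneg (hphi0 y) (hδ0 y)
      linarith
  have hlim : Tendsto (fun s : Finset ι =>
      (∑' y, phi a y * δ y) + B * ∑' y, (if y ∈ s then (0 : ℝ) else δ y)) atTop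
      (𝓝 ((∑' y, phi a y * δ y) + B * 0)) :=
    ((tendsto_tsum_ite_compl hδ0 hδs).const_mul B).const_add _
  have h := ge_of_tendsto' hlim htail
  simpa using h

omit [DecidableEq ι] in
/-- All iterates of the simultaneous update started at the constant vector `R` lie in `[0, R]`
when the rows are `≤ c ≤ 1` on the usable sites. [folklore] -/
private theorem iterate_phi_mem [DecidablePred (· ∈ W)] (hR : 0 ≤ R) (hC0 : ∀ x y, 0 ≤ C x y)
    (hCs : ∀ x, Summable (C x))
    {phi : (ι → ℝ) → ι → ℝ} (hphi : ∀ a y, phi a y = if y ∈ W then ∑' z, C y z * a z else a y)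
    {c : ℝ} (hc1 : c ≤ 1) (hrow : ∀ y ∈ W, ∑' z, C y z ≤ c) (n : ℕ) (y : ι) :
    0 ≤ phi^[n] (fun _ => R) y ∧ phi^[n] (fun _ => R) y ≤ R := by
  induction n generalizing y with
  | zero => exact ⟨hR, le_rfl⟩
  | succ n ih =>
    rw [Function.iterate_succ_apply', hphi]
    split_ifs with hy
    · refine ⟨tsum_nonneg fun z => mul_nonneg (hC0 y z) (ih z).1, ?_⟩
      have hs : Summable fun z => C y z * phi^[n] (fun _ => R) z :=
        summable_row_mul_of_bdd (hC0 y) (hCs y) (fun z => (ih z).1) (fun z => (ih z).2)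
      calc ∑' z, C y z * phi^[n] (fun _ => R) z ≤ ∑' z, C y z * R :=
            hs.tsum_le_tsum (fun z => mul_le_mul_of_nonneg_left (ih z).2 (hC0 y z))
              ((hCs y).mul_right R)
        _ = (∑' z, C y z) * R := tsum_mul_right
        _ ≤ 1 * R := mul_le_mul_of_nonneg_right ((hrow y hy).trans hc1) hR
        _ = R := one_mul R
    · exact ih y

omit [DecidableEq ι] in
/-- Off the usable sites the iterates never move. [folklore] -/
private theorem iterate_phi_of_not_mem [DecidablePred (· ∈ W)]
    {phi : (ι → ℝ) → ι → ℝ} (hphi : ∀ a y, phi a y = if y ∈ W then ∑' z, C y z * a z else a y)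
    (n : ℕ) {y : ι} (hy : y ∉ W) : phi^[n] (fun _ => R) y = R := by
  induction n with
  | zero => rfl
  | succ n ih => rw [Function.iterate_succ_apply', hphi, if_neg hy, ih]

/-- **All iterates `Φⁿ R` are estimates** (Föllmer 1988, Ch. I, "applying the lemma successively"),
for two monotone-normalised functionals invariant under the usable one-site operators, summable
rows `≤ c ≤ 1` on the usable sites. [cite: Follmer1988, Ch. I Comparison Theorem (2.8)] -/
theorem est_iterate_phi_tsum [DecidablePred (· ∈ W)] (hR : 0 ≤ R)
    (hlip0 : ∀ ⦃F : Ω → ℝ⦄ ⦃δ : ι → ℝ⦄, Lip F δ → ∀ y, 0 ≤ δ y)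
    (hlips : ∀ ⦃F : Ω → ℝ⦄ ⦃δ : ι → ℝ⦄, Lip F δ → Summable δ)
    (hosc : ∀ ⦃F : Ω → ℝ⦄ ⦃δ : ι → ℝ⦄, Adm F → Lip F δ → ∀ σ τ, |F σ - F τ| ≤ R * ∑' y, δ y)
    (hC0 : ∀ x y, 0 ≤ C x y) (hCs : ∀ x, Summable (C x))
    (hT : ∀ ⦃F : Ω → ℝ⦄ (x : ι), Adm F → Adm (T x F))
    (hdust : ∀ ⦃F : Ω → ℝ⦄ ⦃δ : ι → ℝ⦄ (x : ι), Adm F → Lip F δ →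
      Lip (T x F) fun y => if y = x then 0 else δ y + C x y * δ x)
    (h₁le : ∀ ⦃F : Ω → ℝ⦄ ⦃M : ℝ⦄, Adm F → (∀ σ, F σ ≤ M) → E₁ F ≤ M)
    (h₁ge : ∀ ⦃F : Ω → ℝ⦄ ⦃M : ℝ⦄, Adm F → (∀ σ, M ≤ F σ) → M ≤ E₁ F)
    (h₁T : ∀ ⦃F : Ω → ℝ⦄ (x : ι), x ∈ W → Adm F → E₁ (T x F) = E₁ F)
    (h₂le : ∀ ⦃F : Ω → ℝ⦄ ⦃M : ℝ⦄, Adm F → (∀ σ, F σ ≤ M) → E₂ F ≤ M)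
    (h₂ge : ∀ ⦃F : Ω → ℝ⦄ ⦃M : ℝ⦄, Adm F → (∀ σ, M ≤ F σ) → M ≤ E₂ F)
    (h₂T : ∀ ⦃F : Ω → ℝ⦄ (x : ι), x ∈ W → Adm F → E₂ (T x F) = E₂ F)
    {phi : (ι → ℝ) → ι → ℝ} (hphi : ∀ a y, phi a y = if y ∈ W then ∑' z, C y z * a z else a y)
    {c : ℝ} (hc1 : c ≤ 1) (hrow : ∀ y ∈ W, ∑' z, C y z ≤ c)
    (n : ℕ) ⦃F : Ω → ℝ⦄ ⦃δ : ι → ℝ⦄ (hF : Adm F) (hδ : Lip F δ) :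
    |E₁ F - E₂ F| ≤ ∑' y, phi^[n] (fun _ => R) y * δ y := by
  induction n generalizing F δ with
  | zero => exact est_const_tsum hosc h₁le h₁ge h₂le h₂ge hF hδ
  | succ n ih =>
    rw [Function.iterate_succ_apply']
    have hmem := iterate_phi_mem hR hC0 hCs hphi hc1 hrow n
    have hmem' := iterate_phi_mem hR hC0 hCs hphi hc1 hrow (n + 1)
    refine est_phi_tsum hlip0 hlips hC0 hCs hT hdust h₁T h₂T hphi ih (fun y => (hmem y).1)
      (fun y => (hmem y).2) (fun y => ?_) hF hδ
    have h := (hmem' y).2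
    rwa [Function.iterate_succ_apply'] at h

omit [DecidableEq ι] in
/-- **The weighted contraction with summable rows** (Föllmer 1988, Ch. I, Cor. (2.14); Georgii
2011, Remark 8.26): rows `≤ c ≤ 1` on `W`, a weight `0 ≤ θ ≤ 1` with `θ = 1` off `W` and
`∑' z, C y z θ z ≤ c θ y` on `W` give `(Φⁿ R)_y ≤ R (cⁿ + θ y)`. [cite: Follmer1988, Ch. I Corollary (2.14)] -/
theorem iterate_phi_le_weighted_tsum [DecidablePred (· ∈ W)] (hR : 0 ≤ R)
    (hC0 : ∀ x y, 0 ≤ C x y) (hCs : ∀ x, Summable (C x))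
    {phi : (ι → ℝ) → ι → ℝ} (hphi : ∀ a y, phi a y = if y ∈ W then ∑' z, C y z * a z else a y)
    {c : ℝ} (hc0 : 0 ≤ c) (hc1 : c ≤ 1) (hrow : ∀ y ∈ W, ∑' z, C y z ≤ c) {θ : ι → ℝ}
    (hθ0 : ∀ y, 0 ≤ θ y) (hθ1 : ∀ y, θ y ≤ 1) (hθW : ∀ y ∉ W, θ y = 1)
    (hroww : ∀ y ∈ W, ∑' z, C y z * θ z ≤ c * θ y) (n : ℕ) (y : ι) :
    phi^[n] (fun _ => R) y ≤ R * (c ^ n + θ y) := by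
  induction n generalizing y with
  | zero =>
    simp only [Function.iterate_zero, id_eq, pow_zero]
    nlinarith [hθ0 y]
  | succ n ih =>
    by_cases hy : y ∈ W
    · rw [Function.iterate_succ_apply', hphi, if_pos hy]
      have hmem := iterate_phi_mem hR hC0 hCs hphi hc1 hrow n
      have hs : Summable fun z => C y z * phi^[n] (fun _ => R) z :=
        summable_row_mul_of_bdd (hC0 y) (hCs y) (fun z => (hmem z).1) (fun z => (hmem z).2)
      have hsθ : Summable fun z => C y z * θ z := summable_row_mul_of_bdd (hC0 y) (hCs y) hθ0 hθ1
      have hs2 : Summable fun z => C y z * (R * (c ^ n + θ z)) := by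
        have : (fun z => C y z * (R * (c ^ n + θ z))) =
            fun z => R * c ^ n * C y z + R * (C y z * θ z) := funext fun z => by ring
        rw [this]
        exact (((hCs y).mul_left (R * c ^ n)).add (hsθ.mul_left R))
      calc ∑' z, C y z * phi^[n] (fun _ => R) z
          ≤ ∑' z, C y z * (R * (c ^ n + θ z)) :=
            hs.tsum_le_tsum (fun z => mul_le_mul_of_nonneg_left (ih z) (hC0 y z)) hs2
        _ = R * c ^ n * ∑' z, C y z + R * ∑' z, C y z * θ z := by
            rw [← tsum_mul_left, ← tsum_mul_left, ← ((hCs y).mul_left (R * c ^ n)).tsum_add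
              (hsθ.mul_left R)]
            exact tsum_congr fun z => by ring
        _ ≤ R * c ^ n * c + R * (c * θ y) :=
            add_le_add (mul_le_mul_of_nonneg_left (hrow y hy) (mul_nonneg hR (pow_nonneg hc0 n)))
              (mul_le_mul_of_nonneg_left (hroww y hy) hR)
        _ ≤ R * (c ^ (n + 1) + θ y) := by
            have h1 : c * θ y ≤ θ y := by nlinarith [hθ0 y]
            have h2 : R * (c * θ y) ≤ R * θ y := mul_le_mul_of_nonneg_left h1 hR
            rw [pow_succ]
            linarith
    · rw [iterate_phi_of_not_mem hphi (n + 1) hy, hθW y hy]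
      nlinarith [pow_nonneg hc0 (n + 1)]

/-- **Dobrushin's comparison estimate under the weighted row-sum condition, summable rows,
Vasserstein form** (Föllmer 1988, Ch. I, Comparison Theorem (2.8) with Cor. (2.14) and Remark
(2.17); Georgii 2011, Thm. 8.20 / Remark 8.26): for two monotone-normalised functionals invariant
under the usable one-site operators, summable rows `≤ c < 1` on `W`, a weight `0 ≤ θ ≤ 1`, `= 1`
off `W`, with `∑' z, C y z θ z ≤ c θ y` on `W`, every admissible `F` with (summable) Lipschitz
vector `δ` satisfies `|E₁ F - E₂ F| ≤ R ∑' y, θ y δ y`.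
[cite: Follmer1988, Ch. I Comparison Theorem (2.8)] -/
theorem abs_sub_le_tsum_weighted [DecidablePred (· ∈ W)] (hR : 0 ≤ R)
    (hlip0 : ∀ ⦃F : Ω → ℝ⦄ ⦃δ : ι → ℝ⦄, Lip F δ → ∀ y, 0 ≤ δ y)
    (hlips : ∀ ⦃F : Ω → ℝ⦄ ⦃δ : ι → ℝ⦄, Lip F δ → Summable δ)
    (hosc : ∀ ⦃F : Ω → ℝ⦄ ⦃δ : ι → ℝ⦄, Adm F → Lip F δ → ∀ σ τ, |F σ - F τ| ≤ R * ∑' y, δ y)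
    (hC0 : ∀ x y, 0 ≤ C x y) (hCs : ∀ x, Summable (C x))
    (hT : ∀ ⦃F : Ω → ℝ⦄ (x : ι), Adm F → Adm (T x F))
    (hdust : ∀ ⦃F : Ω → ℝ⦄ ⦃δ : ι → ℝ⦄ (x : ι), Adm F → Lip F δ →
      Lip (T x F) fun y => if y = x then 0 else δ y + C x y * δ x)
    (h₁le : ∀ ⦃F : Ω → ℝ⦄ ⦃M : ℝ⦄, Adm F → (∀ σ, F σ ≤ M) → E₁ F ≤ M)
    (h₁ge : ∀ ⦃F : Ω → ℝ⦄ ⦃M : ℝ⦄, Adm F → (∀ σ, M ≤ F σ) → M ≤ E₁ F)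
    (h₁T : ∀ ⦃F : Ω → ℝ⦄ (x : ι), x ∈ W → Adm F → E₁ (T x F) = E₁ F)
    (h₂le : ∀ ⦃F : Ω → ℝ⦄ ⦃M : ℝ⦄, Adm F → (∀ σ, F σ ≤ M) → E₂ F ≤ M)
    (h₂ge : ∀ ⦃F : Ω → ℝ⦄ ⦃M : ℝ⦄, Adm F → (∀ σ, M ≤ F σ) → M ≤ E₂ F)
    (h₂T : ∀ ⦃F : Ω → ℝ⦄ (x : ι), x ∈ W → Adm F → E₂ (T x F) = E₂ F)
    {c : ℝ} (hc0 : 0 ≤ c) (hc1 : c < 1) (hrow : ∀ y ∈ W, ∑' z, C y z ≤ c) {θ : ι → ℝ}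
    (hθ0 : ∀ y, 0 ≤ θ y) (hθ1 : ∀ y, θ y ≤ 1) (hθW : ∀ y ∉ W, θ y = 1)
    (hroww : ∀ y ∈ W, ∑' z, C y z * θ z ≤ c * θ y)
    ⦃F : Ω → ℝ⦄ ⦃δ : ι → ℝ⦄ (hF : Adm F) (hδ : Lip F δ) :
    |E₁ F - E₂ F| ≤ R * ∑' y, θ y * δ y := by
  set phi : (ι → ℝ) → ι → ℝ := fun a y => if y ∈ W then ∑' z, C y z * a z else a y with hphidef
  have hphi : ∀ a y, phi a y = if y ∈ W then ∑' z, C y z * a z else a y := fun _ _ => rfl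
  have hδ0 := hlip0 hδ
  have hδs := hlips hδ
  have hsθ : Summable fun y => θ y * δ y := summable_mul_of_bdd hθ0 hθ1 hδ0 hδs
  have hB : ∀ n : ℕ, |E₁ F - E₂ F| ≤ R * c ^ n * ∑' y, δ y + R * ∑' y, θ y * δ y := fun n => by
    have hmem := iterate_phi_mem hR hC0 hCs hphi hc1.le hrow n
    refine (est_iterate_phi_tsum hR hlip0 hlips hosc hC0 hCs hT hdust h₁le h₁ge h₁T h₂le h₂ge h₂T
      hphi hc1.le hrow n hF hδ).trans ?_
    have hs : Summable fun y => phi^[n] (fun _ => R) y * δ y :=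
      summable_mul_of_bdd (fun y => (hmem y).1) (fun y => (hmem y).2) hδ0 hδs
    rw [← tsum_mul_left, ← tsum_mul_left, ← (hδs.mul_left (R * c ^ n)).tsum_add (hsθ.mul_left R)]
    refine hs.tsum_le_tsum (fun y => ?_) ((hδs.mul_left (R * c ^ n)).add (hsθ.mul_left R))
    have h1 : phi^[n] (fun _ => R) y ≤ R * (c ^ n + θ y) :=
      iterate_phi_le_weighted_tsum hR hC0 hCs hphi hc0 hc1.le hrow hθ0 hθ1 hθW hroww n y
    have h2 : phi^[n] (fun _ => R) y * δ y ≤ R * (c ^ n + θ y) * δ y :=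
      mul_le_mul_of_nonneg_right h1 (hδ0 y)
    refine h2.trans (le_of_eq ?_)
    ring
  have hlim : Tendsto (fun n : ℕ => R * c ^ n * ∑' y, δ y + R * ∑' y, θ y * δ y)
      atTop (𝓝 (R * 0 * ∑' y, δ y + R * ∑' y, θ y * δ y)) :=
    ((((tendsto_pow_atTop_nhds_zero_of_lt_one hc0 hc1).const_mul R).mul_const _).add_const _)
  have h := ge_of_tendsto' hlim hB
  simpa using h

/-- **Equality of invariant states under Dobrushin's condition with summable rows** (Föllmer
1988, Ch. I, Uniqueness theorem (2.9) with Remark (2.17): `|μ(f) - ν(f)| ≤ R cⁿ ∑ δ(f) → 0`;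
Friedli–Velenik 2017, proof of Thm. 6.31): if every site is usable and the rows are `≤ c < 1`,
two invariant monotone-normalised functionals agree on every admissible `F`.
[cite: Follmer1988, Ch. I Uniqueness theorem (2.9)] -/
theorem eq_of_lt_one_tsum (hR : 0 ≤ R)
    (hlip0 : ∀ ⦃F : Ω → ℝ⦄ ⦃δ : ι → ℝ⦄, Lip F δ → ∀ y, 0 ≤ δ y)
    (hlips : ∀ ⦃F : Ω → ℝ⦄ ⦃δ : ι → ℝ⦄, Lip F δ → Summable δ)
    (hosc : ∀ ⦃F : Ω → ℝ⦄ ⦃δ : ι → ℝ⦄, Adm F → Lip F δ → ∀ σ τ, |F σ - F τ| ≤ R * ∑' y, δ y)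
    (hC0 : ∀ x y, 0 ≤ C x y) (hCs : ∀ x, Summable (C x))
    (hT : ∀ ⦃F : Ω → ℝ⦄ (x : ι), Adm F → Adm (T x F))
    (hdust : ∀ ⦃F : Ω → ℝ⦄ ⦃δ : ι → ℝ⦄ (x : ι), Adm F → Lip F δ →
      Lip (T x F) fun y => if y = x then 0 else δ y + C x y * δ x)
    (h₁le : ∀ ⦃F : Ω → ℝ⦄ ⦃M : ℝ⦄, Adm F → (∀ σ, F σ ≤ M) → E₁ F ≤ M)
    (h₁ge : ∀ ⦃F : Ω → ℝ⦄ ⦃M : ℝ⦄, Adm F → (∀ σ, M ≤ F σ) → M ≤ E₁ F)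
    (h₁T : ∀ ⦃F : Ω → ℝ⦄ (x : ι), Adm F → E₁ (T x F) = E₁ F)
    (h₂le : ∀ ⦃F : Ω → ℝ⦄ ⦃M : ℝ⦄, Adm F → (∀ σ, F σ ≤ M) → E₂ F ≤ M)
    (h₂ge : ∀ ⦃F : Ω → ℝ⦄ ⦃M : ℝ⦄, Adm F → (∀ σ, M ≤ F σ) → M ≤ E₂ F)
    (h₂T : ∀ ⦃F : Ω → ℝ⦄ (x : ι), Adm F → E₂ (T x F) = E₂ F)
    {c : ℝ} (hc0 : 0 ≤ c) (hc1 : c < 1) (hrow : ∀ y, ∑' z, C y z ≤ c)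
    ⦃F : Ω → ℝ⦄ ⦃δ : ι → ℝ⦄ (hF : Adm F) (hδ : Lip F δ) :
    E₁ F = E₂ F := by
  classical
  have h := abs_sub_le_tsum_weighted (W := Set.univ) hR hlip0 hlips hosc hC0 hCs hT hdust h₁le
    h₁ge (fun F x _ hF => h₁T x hF) h₂le h₂ge (fun F x _ hF => h₂T x hF) hc0 hc1
    (fun y _ => hrow y) (θ := fun _ => 0) (fun _ => le_rfl) (fun _ => zero_le_one)
    (fun y hy => (hy (Set.mem_univ y)).elim)
    (fun y _ => by simp) hF hδ
  have h0 : |E₁ F - E₂ F| ≤ 0 := by simpa using h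
  exact sub_eq_zero.1 (abs_nonpos_iff.1 h0)

end Abstract

/-! ### The measure theory: one-site laws with the global Kantorovich–Rubinstein bound -/

section States

variable {V S : Type*} [MeasurableSpace S] {γ : Specification V S} {r : S → S → ℝ}
  {C : V → V → ℝ}

/-- **The one-site law at `x` does not depend on the spin at `x`** (Georgii 2011, Def. 1.23 (ii):
`η ↦ γ_Λ(A | η)` is `𝓕_{Λᶜ}`-measurable, hence determined by the coordinates off `Λ`; Föllmer
1988, Ch. I, §2.1: `π_k(· | η)` is "the conditional distribution of `ω(k)` given `𝓕_{I - {k}}`").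
No finite-range hypothesis is involved. [cite: Georgii2011, Def. 1.23] -/
theorem siteLaw_congr_of_eq_off' (hγ : IsSpecification γ) (x : V) {ω η : V → S}
    (h : ∀ z, z ≠ x → ω z = η z) : siteLaw γ x ω = siteLaw γ x η := by
  have hγx : γ {x} ω = γ {x} η := by
    refine Measure.ext fun A hA => ?_
    -- an `𝓕_{{x}ᶜ}`-measurable function is determined by the coordinates off `x`
    set P : Set V := ((↑({x} : Finset V) : Set V)ᶜ) with hP
    have hle : cylinderEvents (X := fun _ : V => S) P ≤
        MeasurableSpace.comap (fun σ : V → S => Set.restrict P σ) ⊤ := by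
      refine iSup₂_le fun y hy => ?_
      have hcomp : (fun σ : V → S => σ y) = (fun g : P → S => g ⟨y, hy⟩) ∘
          fun σ : V → S => Set.restrict P σ := rfl
      rw [hcomp, ← MeasurableSpace.comap_comp]
      exact MeasurableSpace.comap_mono le_top
    have hm : MeasurableSet[MeasurableSpace.comap (fun σ : V → S => Set.restrict P σ) ⊤]
        ((fun η' : V → S => γ {x} η' A) ⁻¹' {γ {x} ω A}) :=
      hle _ (hγ.measurable {x} A hA (measurableSet_singleton _))
    rcases hm with ⟨t, -, ht⟩
    have hr : Set.restrict P ω = Set.restrict P η := funext fun z =>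
      h z fun hz => (Set.mem_compl_iff _ _).1 z.2 (by simp [hz])
    have hω : ω ∈ (fun η' : V → S => γ {x} η' A) ⁻¹' {γ {x} ω A} := rfl
    rw [← ht] at hω
    have hη : η ∈ (fun σ : V → S => Set.restrict P σ) ⁻¹' t := by
      simp only [Set.mem_preimage] at hω ⊢
      rwa [← hr]
    rw [ht] at hη
    exact hη.symm
  rw [siteLaw, siteLaw, hγx]

/-- **The dusting estimate in the global Lipschitz form, infinite range** (Föllmer 1988, Ch. I,
proof of Lemma (2.5) with (2.20)–(2.21): `δ_i(π_k f) ≤ δ_i(f) + C_{ik} δ_k(f)` for `i ≠ k`,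
`δ_k(π_k f) = 0`; Friedli–Velenik 2017, Lemma 6.34): if the one-site laws of `γ` satisfy the GLOBAL
Kantorovich–Rubinstein bound `|∫ φ dγ_x(·|ω) - ∫ φ dγ_x(·|η)| ≤ L ∑' y, C x y · r(ω y, η y)` for
bounded measurable `L`-Lipschitz `φ` (summable rows), and `|f σ - f τ| ≤ ∑' y, δ y · r(σ y, τ y)`
with `δ` summable, then `T_x f = γ_x f` satisfies the same bound with the vector
`δ' y = [y ≠ x] (δ y + C x y δ x)`. [cite: Follmer1988, Ch. I Lemma (2.5)] -/
theorem lip_siteAvg_tsum [DecidableEq V] (hγ : IsSpecification γ) {R : ℝ}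
    (hr0 : ∀ a b, 0 ≤ r a b) (hrR : ∀ a b, r a b ≤ R) (hr00 : ∀ a, r a a = 0)
    (hC0 : ∀ x y, 0 ≤ C x y) (hCs : ∀ x, Summable (C x))
    (hcontr : ∀ (x : V) (ω η : V → S) (φ : S → ℝ) (L : ℝ), Measurable φ →
      (∃ M, ∀ s, |φ s| ≤ M) → 0 ≤ L → (∀ a b, |φ a - φ b| ≤ L * r a b) →
      |∫ s, φ s ∂(siteLaw γ x ω) - ∫ s, φ s ∂(siteLaw γ x η)| ≤
        L * ∑' y, C x y * r (ω y) (η y))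
    (x : V) {f : (V → S) → ℝ} (hfm : Measurable f) {M : ℝ} (hM : ∀ σ, |f σ| ≤ M)
    {δ : V → ℝ} (hδ0 : ∀ y, 0 ≤ δ y) (hδs : Summable δ)
    (hδ : ∀ σ τ, |f σ - f τ| ≤ ∑' y, δ y * r (σ y) (τ y)) (σ τ : V → S) :
    |siteAvg γ x f σ - siteAvg γ x f τ| ≤
      ∑' y, (if y = x then 0 else δ y + C x y * δ x) * r (σ y) (τ y) := by
  haveI := isProbabilityMeasure_siteLaw hγ x σ
  haveI := isProbabilityMeasure_siteLaw hγ x τ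
  -- replace `σ` by `σ'` agreeing with `τ` at `x`: same one-site law
  set σ' : V → S := Function.update σ x (τ x) with hσ'
  have hlaw : siteLaw γ x σ = siteLaw γ x σ' :=
    siteLaw_congr_of_eq_off' hγ x fun z hz => by rw [hσ', Function.update_of_ne hz]
  haveI := isProbabilityMeasure_siteLaw hγ x σ'
  have hmeas : ∀ ρ : V → S, Measurable fun s => f (Function.update ρ x s) := fun ρ =>
    hfm.comp (measurable_update ρ)
  have hint : ∀ (ρ : V → S) (m : Measure S) [IsFiniteMeasure m],
      Integrable (fun s => f (Function.update ρ x s)) m := fun ρ m _ =>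
    Integrable.of_bound (hmeas ρ).aestronglyMeasurable M (ae_of_all _ fun s => by
      rw [Real.norm_eq_abs]; exact hM _)
  -- summabilities
  have hsδ : Summable fun y => (if y = x then 0 else δ y) * r (σ y) (τ y) :=
    Summable.of_nonneg_of_le
      (fun y => mul_nonneg (by split_ifs; exacts [le_rfl, hδ0 y]) (hr0 _ _))
      (fun y => by
        split_ifs
        · rw [zero_mul]; exact mul_nonneg (hδ0 y) ((hr0 _ _).trans (hrR (σ y) (τ y)))
        · exact mul_le_mul_of_nonneg_left (hrR _ _) (hδ0 y))
      (hδs.mul_right R)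
  have hsC : Summable fun y => (if y = x then 0 else C x y) * r (σ y) (τ y) :=
    Summable.of_nonneg_of_le
      (fun y => mul_nonneg (by split_ifs; exacts [le_rfl, hC0 x y]) (hr0 _ _))
      (fun y => by
        split_ifs
        · rw [zero_mul]; exact mul_nonneg (hC0 x y) ((hr0 _ _).trans (hrR (σ y) (τ y)))
        · exact mul_le_mul_of_nonneg_left (hrR _ _) (hC0 x y))
      ((hCs x).mul_right R)
  -- first term: transport of the boundary condition inside `f`
  have h1 : |∫ s, f (Function.update σ x s) ∂(siteLaw γ x σ') -
      ∫ s, f (Function.update τ x s) ∂(siteLaw γ x σ')| ≤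
      ∑' y, (if y = x then 0 else δ y) * r (σ y) (τ y) := by
    rw [← integral_sub (hint σ _) (hint τ _)]
    have hpt : ∀ s, |f (Function.update σ x s) - f (Function.update τ x s)| ≤
        ∑' y, (if y = x then 0 else δ y) * r (σ y) (τ y) := fun s => by
      refine (hδ _ _).trans (le_of_eq (tsum_congr fun y => ?_))
      by_cases hyx : y = x
      · subst hyx; simp [hr00]
      · rw [if_neg hyx, Function.update_of_ne hyx, Function.update_of_ne hyx]
    have h := norm_integral_le_of_norm_le_const (μ := siteLaw γ x σ')
      (f := fun s => f (Function.update σ x s) - f (Function.update τ x s))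
      (C := ∑' y, (if y = x then 0 else δ y) * r (σ y) (τ y))
      (ae_of_all _ fun s => by rw [Real.norm_eq_abs]; exact hpt s)
    simpa using h
  -- second term: the global Kantorovich–Rubinstein bound for `ψ(s) = f(τ^{x←s})`
  have hψ : ∀ a b, |f (Function.update τ x a) - f (Function.update τ x b)| ≤ δ x * r a b :=
    fun a b => by
    refine (hδ _ _).trans (le_of_eq ?_)
    rw [tsum_eq_single x (fun y hyx => by
      rw [Function.update_of_ne hyx, Function.update_of_ne hyx, hr00, mul_zero])]
    simp
  have h2 : |∫ s, f (Function.update τ x s) ∂(siteLaw γ x σ') -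
      ∫ s, f (Function.update τ x s) ∂(siteLaw γ x τ)| ≤
      δ x * ∑' y, (if y = x then 0 else C x y) * r (σ y) (τ y) := by
    refine (hcontr x σ' τ (fun s => f (Function.update τ x s)) (δ x) (hmeas τ) ⟨M, fun s => hM _⟩
      (hδ0 x) hψ).trans (le_of_eq ?_)
    congr 1
    refine tsum_congr fun y => ?_
    by_cases hyx : y = x
    · subst hyx; simp [hσ', hr00]
    · rw [if_neg hyx, hσ', Function.update_of_ne hyx]
  rw [siteAvg_eq_integral_siteLaw hγ x hfm, siteAvg_eq_integral_siteLaw hγ x hfm, hlaw]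
  calc |∫ s, f (Function.update σ x s) ∂(siteLaw γ x σ') -
        ∫ s, f (Function.update τ x s) ∂(siteLaw γ x τ)|
      ≤ |∫ s, f (Function.update σ x s) ∂(siteLaw γ x σ') -
          ∫ s, f (Function.update τ x s) ∂(siteLaw γ x σ')| +
        |∫ s, f (Function.update τ x s) ∂(siteLaw γ x σ') -
          ∫ s, f (Function.update τ x s) ∂(siteLaw γ x τ)| := abs_sub_le _ _ _
    _ ≤ (∑' y, (if y = x then 0 else δ y) * r (σ y) (τ y)) +
        δ x * ∑' y, (if y = x then 0 else C x y) * r (σ y) (τ y) := add_le_add h1 h2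
    _ = ∑' y, (if y = x then 0 else δ y + C x y * δ x) * r (σ y) (τ y) := by
        rw [← tsum_mul_left, ← hsδ.tsum_add (hsC.mul_left (δ x))]
        refine tsum_congr fun y => ?_
        split_ifs <;> ring

/-! ### Instantiating the abstract layer: bounded measurable observables with summable global
Lipschitz vectors; Gibbs measures and their tilts as invariant states -/

/-- The hypotheses of the abstract layer for the one-site operators `T_x = γ_x` acting on bounded
measurable observables with summable global `r`-Lipschitz vectors (Föllmer 1988, Ch. I, Remark
(2.17): the class `L(Ω)`, and the dusting estimate (2.5)/(2.20)). The two predicates are passed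
abstractly and characterised by `hAdm`, `hLip`. [cite: Follmer1988, Ch. I Remark (2.17)] -/
private theorem layer_hyps [DecidableEq V] (hγ : IsSpecification γ) {R : ℝ}
    (hr0 : ∀ a b, 0 ≤ r a b) (hrR : ∀ a b, r a b ≤ R) (hr00 : ∀ a, r a a = 0)
    (hC0 : ∀ x y, 0 ≤ C x y) (hCs : ∀ x, Summable (C x))
    (hcontr : ∀ (x : V) (ω η : V → S) (φ : S → ℝ) (L : ℝ), Measurable φ →
      (∃ M, ∀ s, |φ s| ≤ M) → 0 ≤ L → (∀ a b, |φ a - φ b| ≤ L * r a b) →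
      |∫ s, φ s ∂(siteLaw γ x ω) - ∫ s, φ s ∂(siteLaw γ x η)| ≤
        L * ∑' y, C x y * r (ω y) (η y))
    {Adm : ((V → S) → ℝ) → Prop} (hAdm : ∀ F, Adm F ↔ (Measurable F ∧ ∃ M, ∀ σ, |F σ| ≤ M))
    {Lip : ((V → S) → ℝ) → (V → ℝ) → Prop}
    (hLip : ∀ F δ, Lip F δ ↔
      ((∀ y, 0 ≤ δ y) ∧ Summable δ ∧ ∀ σ τ, |F σ - F τ| ≤ ∑' y, δ y * r (σ y) (τ y))) :
    (∀ ⦃F : (V → S) → ℝ⦄ ⦃δ : V → ℝ⦄, Lip F δ → ∀ y, 0 ≤ δ y) ∧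
    (∀ ⦃F : (V → S) → ℝ⦄ ⦃δ : V → ℝ⦄, Lip F δ → Summable δ) ∧
    (∀ ⦃F : (V → S) → ℝ⦄ ⦃δ : V → ℝ⦄, Adm F → Lip F δ →
      ∀ σ τ, |F σ - F τ| ≤ R * ∑' y, δ y) ∧
    (∀ ⦃F : (V → S) → ℝ⦄ (x : V), Adm F → Adm (siteAvg γ x F)) ∧
    (∀ ⦃F : (V → S) → ℝ⦄ ⦃δ : V → ℝ⦄ (x : V), Adm F → Lip F δ →
      Lip (siteAvg γ x F) fun y => if y = x then 0 else δ y + C x y * δ x) := by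
  refine ⟨fun F δ h => ((hLip F δ).1 h).1, fun F δ h => ((hLip F δ).1 h).2.1,
    fun F δ _ h σ τ => ?_, fun F x hF => ?_, fun F δ x hF h => ?_⟩
  · obtain ⟨hδ0, hδs, hδ⟩ := (hLip F δ).1 h
    refine (hδ σ τ).trans ?_
    have hs : Summable fun y => δ y * r (σ y) (τ y) :=
      Summable.of_nonneg_of_le (fun y => mul_nonneg (hδ0 y) (hr0 _ _))
        (fun y => mul_le_mul_of_nonneg_left (hrR _ _) (hδ0 y)) (hδs.mul_right R)
    calc ∑' y, δ y * r (σ y) (τ y) ≤ ∑' y, δ y * R :=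
          hs.tsum_le_tsum (fun y => mul_le_mul_of_nonneg_left (hrR _ _) (hδ0 y)) (hδs.mul_right R)
      _ = R * ∑' y, δ y := by rw [tsum_mul_right, mul_comm]
  · obtain ⟨hFm, M, hM⟩ := (hAdm F).1 hF
    exact (hAdm _).2 ⟨measurable_siteAvg hγ x hFm, M, fun σ => abs_siteAvg_le hγ x hM σ⟩
  · obtain ⟨hFm, M, hM⟩ := (hAdm F).1 hF
    obtain ⟨hδ0, hδs, hδ⟩ := (hLip F δ).1 h
    refine (hLip _ _).2 ⟨fun y => ?_, ?_, lip_siteAvg_tsum hγ hr0 hrR hr00 hC0 hCs hcontr x hFm hM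
      hδ0 hδs hδ⟩
    · split_ifs
      · exact le_rfl
      · exact add_nonneg (hδ0 y) (mul_nonneg (hC0 x y) (hδ0 x))
    · exact Summable.of_nonneg_of_le
        (fun y => by
          split_ifs; exacts [le_rfl, add_nonneg (hδ0 y) (mul_nonneg (hC0 x y) (hδ0 x))])
        (fun y => by
          split_ifs
          · exact add_nonneg (hδ0 y) (mul_nonneg (hC0 x y) (hδ0 x))
          · exact le_rfl)
        (hδs.add ((hCs x).mul_right (δ x)))

/-- **A Gibbs measure is an invariant monotone-normalised state for every one-site operator**
(DLR equations; Föllmer 1988, Ch. I, proof of Lemma (2.5), first display; Georgii 2011, Thm. 8.7).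
[cite: Follmer1988, Ch. I Lemma (2.5)] -/
private theorem state_gibbs (hγ : IsSpecification γ)
    {Adm : ((V → S) → ℝ) → Prop} (hAdm : ∀ F, Adm F ↔ (Measurable F ∧ ∃ M, ∀ σ, |F σ| ≤ M))
    {μ : Measure (V → S)} (hμ : IsGibbsMeasure γ μ) :
    (∀ ⦃F : (V → S) → ℝ⦄ ⦃M : ℝ⦄, Adm F → (∀ σ, F σ ≤ M) → ∫ σ, F σ ∂μ ≤ M) ∧
    (∀ ⦃F : (V → S) → ℝ⦄ ⦃M : ℝ⦄, Adm F → (∀ σ, M ≤ F σ) → M ≤ ∫ σ, F σ ∂μ) ∧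
    (∀ ⦃F : (V → S) → ℝ⦄ (x : V), Adm F → ∫ σ, siteAvg γ x F σ ∂μ = ∫ σ, F σ ∂μ) := by
  haveI := hμ.isProbabilityMeasure
  refine ⟨fun F M hF hM => ?_, fun F M hF hM => ?_, fun F x hF => ?_⟩
  · obtain ⟨hFm, B, hB⟩ := (hAdm F).1 hF
    calc ∫ σ, F σ ∂μ ≤ ∫ _σ, M ∂μ := integral_mono (integrable_of_abs_le' hFm hB)
          (integrable_const M) hM
      _ = M := by simp
  · obtain ⟨hFm, B, hB⟩ := (hAdm F).1 hF
    calc M = ∫ _σ, M ∂μ := by simp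
      _ ≤ ∫ σ, F σ ∂μ := integral_mono (integrable_const M) (integrable_of_abs_le' hFm hB) hM
  · obtain ⟨hFm, B, hB⟩ := (hAdm F).1 hF
    exact hμ.integral_integral_eq hγ {x} (integrable_of_abs_le' hFm hB)

/-- **The tilt of a Gibbs measure by a nonnegative local density is an invariant state off the
support of the density** (properness and DLR; Föllmer 1988, Ch. I, proof of Thm. (2.13):
`dν = g dμ`; Georgii 2011, §8.2; Künsch 1982). [cite: Follmer1988, Ch. I Theorem (2.13)] -/
private theorem state_tilt (hγ : IsSpecification γ)
    {Adm : ((V → S) → ℝ) → Prop} (hAdm : ∀ F, Adm F ↔ (Measurable F ∧ ∃ M, ∀ σ, |F σ| ≤ M))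
    {μ : Measure (V → S)} (hμ : IsGibbsMeasure γ μ) {g : (V → S) → ℝ} (hgm : Measurable g)
    {Δg : Finset V} (hgdep : DependsOn g (↑Δg : Set V)) (hg0 : ∀ σ, 0 ≤ g σ) {B : ℝ}
    (hgB : ∀ σ, g σ ≤ B) (hgpos : 0 < ∫ σ, g σ ∂μ) :
    (∀ ⦃F : (V → S) → ℝ⦄ ⦃M : ℝ⦄, Adm F → (∀ σ, F σ ≤ M) →
      (∫ σ, g σ * F σ ∂μ) / ∫ σ, g σ ∂μ ≤ M) ∧
    (∀ ⦃F : (V → S) → ℝ⦄ ⦃M : ℝ⦄, Adm F → (∀ σ, M ≤ F σ) →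
      M ≤ (∫ σ, g σ * F σ ∂μ) / ∫ σ, g σ ∂μ) ∧
    (∀ ⦃F : (V → S) → ℝ⦄ (x : V), x ∈ ((↑Δg : Set V)ᶜ) → Adm F →
      (∫ σ, g σ * siteAvg γ x F σ ∂μ) / ∫ σ, g σ ∂μ = (∫ σ, g σ * F σ ∂μ) / ∫ σ, g σ ∂μ) := by
  haveI := hμ.isProbabilityMeasure
  have hgabs : ∀ σ, |g σ| ≤ B := fun σ => by rw [abs_of_nonneg (hg0 σ)]; exact hgB σ
  have hgi : Integrable g μ := integrable_of_abs_le' hgm hgabs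
  have hgfi : ∀ {F : (V → S) → ℝ}, Measurable F → ∀ {M : ℝ}, (∀ σ, |F σ| ≤ M) →
      Integrable (fun σ => g σ * F σ) μ := fun hFm M hM =>
    hgi.mul_bdd hFm.aestronglyMeasurable (ae_of_all _ fun σ => by
      rw [Real.norm_eq_abs]; exact hM σ)
  refine ⟨fun F M hF hM => ?_, fun F M hF hM => ?_, fun F x hx hF => ?_⟩
  · obtain ⟨hFm, B', hB'⟩ := (hAdm F).1 hF
    rw [div_le_iff₀ hgpos]
    calc ∫ σ, g σ * F σ ∂μ ≤ ∫ σ, g σ * M ∂μ :=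
          integral_mono (hgfi hFm hB') (hgi.mul_const M)
            fun σ => mul_le_mul_of_nonneg_left (hM σ) (hg0 σ)
      _ = M * ∫ σ, g σ ∂μ := by rw [integral_mul_const, mul_comm]
  · obtain ⟨hFm, B', hB'⟩ := (hAdm F).1 hF
    rw [le_div_iff₀ hgpos]
    calc M * ∫ σ, g σ ∂μ = ∫ σ, g σ * M ∂μ := by rw [integral_mul_const, mul_comm]
      _ ≤ ∫ σ, g σ * F σ ∂μ :=
          integral_mono (hgi.mul_const M) (hgfi hFm hB')
            fun σ => mul_le_mul_of_nonneg_left (hM σ) (hg0 σ)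
  · obtain ⟨hFm, B', hB'⟩ := (hAdm F).1 hF
    have hxΔ : x ∉ Δg := fun h => hx (Finset.mem_coe.2 h)
    -- `g` is blind to the spin at `x`, so it commutes with `γ_x` (properness)
    have hpt : ∀ η, g η * siteAvg γ x F η = ∫ σ, g σ * F σ ∂(γ {x} η) := fun η => by
      rw [siteAvg, ← integral_const_mul]
      refine integral_congr_ae ?_
      filter_upwards [hγ.proper {x} η] with σ hσ
      rw [hgdep fun i hi => (hσ i fun hix => hxΔ ?_).symm]
      rwa [Finset.mem_singleton.1 hix] at hi
    congr 1
    simp_rw [hpt]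
    exact hμ.integral_integral_eq hγ {x} (hgfi hFm hB')

omit [MeasurableSpace S] in
/-- A local observable with a coordinatewise Lipschitz bound has the GLOBAL summable Lipschitz
vector `δ 𝟙_Δ` (Föllmer 1988, Ch. I, Remark (2.17): `|f(ω) - f(η)| ≤ ∑_i r(ω(i), η(i)) δ_i(f)`
for functions of finitely many coordinates, by changing one coordinate at a time).
[cite: Follmer1988, Ch. I Remark (2.17)] -/
theorem abs_sub_le_tsum_of_dependsOn [DecidableEq V] {f : (V → S) → ℝ} {Δ : Finset V}
    {δ : V → ℝ} (hdep : DependsOn f (↑Δ : Set V)) (hδ : IsLipBound r f δ) (σ τ : V → S) :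
    |f σ - f τ| ≤ ∑' y, (if y ∈ Δ then δ y else 0) * r (σ y) (τ y) := by
  rw [tsum_eq_sum (s := Δ) (fun y hy => by rw [if_neg hy, zero_mul])]
  refine (abs_sub_le_sum_of_dependsOn hdep hδ σ τ).trans (le_of_eq ?_)
  exact Finset.sum_congr rfl fun y hy => by rw [if_pos hy]

/-! ### Uniqueness -/

section Determine

variable {M : Type*} [PseudoMetricSpace M] [MeasurableSpace M] [BorelSpace M]

/-- **Dobrushin's uniqueness theorem in the Vasserstein form, infinite range with summable rows**
(Föllmer 1988, Ch. I, Uniqueness theorem (2.9) with Remark (2.17) and (2.22); Friedli–Velenik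
2017, Thm. 6.31; Georgii 2011, Thm. 8.7; Dobrushin 1970, Thm. 4): let the one-site laws of the
specification `γ` satisfy the GLOBAL Kantorovich–Rubinstein bound
`|∫ φ dγ_x(·|ω) - ∫ φ dγ_x(·|η)| ≤ L ∑' y, C x y · r(ω y, η y)` (all `ω, η`; bounded measurable
`L`-Lipschitz `φ`) for a weight `0 ≤ r ≤ R` vanishing on the diagonal, with summable rows
`∑' y, C x y ≤ c < 1` — NO finite set of neighbours is assumed. If `r` dominates (up to `A`) the
pseudo-metric `dist ∘ val` of a map `val` generating the σ-algebra of `S`, then `γ` admits at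
most one Gibbs measure. [cite: Follmer1988, Ch. I Uniqueness theorem (2.9)] -/
theorem subsingleton_gibbsMeasures_of_summable [Nonempty S] (hγ : IsSpecification γ)
    {R : ℝ} (hr0 : ∀ a b, 0 ≤ r a b) (hrR : ∀ a b, r a b ≤ R) (hr00 : ∀ a, r a a = 0)
    (hC0 : ∀ x y, 0 ≤ C x y) (hCs : ∀ x, Summable (C x))
    (hcontr : ∀ (x : V) (ω η : V → S) (φ : S → ℝ) (L : ℝ), Measurable φ →
      (∃ M, ∀ s, |φ s| ≤ M) → 0 ≤ L → (∀ a b, |φ a - φ b| ≤ L * r a b) →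
      |∫ s, φ s ∂(siteLaw γ x ω) - ∫ s, φ s ∂(siteLaw γ x η)| ≤
        L * ∑' y, C x y * r (ω y) (η y))
    {c : ℝ} (hc0 : 0 ≤ c) (hc1 : c < 1) (hrow : ∀ x, ∑' y, C x y ≤ c)
    (val : S → M) (hS : ‹MeasurableSpace S› = MeasurableSpace.comap val ‹MeasurableSpace M›)
    {A : ℝ} (hA0 : 0 ≤ A) (hA : ∀ a b, dist (val a) (val b) ≤ A * r a b) :
    (gibbsMeasures γ).Subsingleton := by
  classical
  intro μ hμ ν hν
  haveI := IsGibbsMeasure.isProbabilityMeasure hμ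
  haveI := IsGibbsMeasure.isProbabilityMeasure hν
  have hR : 0 ≤ R := by
    obtain ⟨a⟩ := ‹Nonempty S›
    exact (hr0 a a).trans (hrR a a)
  -- the two predicates of the abstract layer
  set Adm : ((V → S) → ℝ) → Prop := fun F => Measurable F ∧ ∃ M, ∀ σ, |F σ| ≤ M with hAdmdef
  set Lip : ((V → S) → ℝ) → (V → ℝ) → Prop := fun F δ =>
    (∀ y, 0 ≤ δ y) ∧ Summable δ ∧ ∀ σ τ, |F σ - F τ| ≤ ∑' y, δ y * r (σ y) (τ y) with hLipdef
  have hAdm : ∀ F, Adm F ↔ (Measurable F ∧ ∃ M, ∀ σ, |F σ| ≤ M) := fun F => Iff.rfl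
  have hLip : ∀ F δ, Lip F δ ↔
      ((∀ y, 0 ≤ δ y) ∧ Summable δ ∧ ∀ σ τ, |F σ - F τ| ≤ ∑' y, δ y * r (σ y) (τ y)) :=
    fun F δ => Iff.rfl
  obtain ⟨hlip0, hlips, hosc, hT, hdust⟩ :=
    layer_hyps hγ hr0 hrR hr00 hC0 hCs hcontr hAdm hLip
  obtain ⟨h₁le, h₁ge, h₁T⟩ := state_gibbs hγ hAdm hμ
  obtain ⟨h₂le, h₂ge, h₂T⟩ := state_gibbs hγ hAdm hν
  refine measure_eq_of_forall_integral_eq_of_isLipBound val hS fun f Δ δ hfm hdep hf1 hδ => ?_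
  -- the local observable `f` is admissible with the global Lipschitz vector `A δ 𝟙_Δ`
  have hF : Adm f := ⟨hfm, 1, hf1⟩
  have hδ' : Lip f fun y => if y ∈ Δ then A * δ y else 0 := by
    refine ⟨fun y => ?_, ?_, fun σ τ => ?_⟩
    · dsimp only
      split_ifs
      · exact mul_nonneg hA0 (hδ.nonneg y)
      · exact le_rfl
    · exact summable_of_ne_finset_zero (s := Δ) fun y hy => if_neg hy
    · have hδA : IsLipBound r f fun y => A * δ y :=
        ⟨fun y => mul_nonneg hA0 (hδ.nonneg y), fun y σ τ hστ =>
          (hδ.le y σ τ hστ).trans (by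
            calc δ y * dist (val (σ y)) (val (τ y)) ≤ δ y * (A * r (σ y) (τ y)) :=
                  mul_le_mul_of_nonneg_left (hA _ _) (hδ.nonneg y)
              _ = A * δ y * r (σ y) (τ y) := by ring)⟩
      exact abs_sub_le_tsum_of_dependsOn hdep hδA σ τ
  exact eq_of_lt_one_tsum (T := fun x F => siteAvg γ x F) (E₁ := fun F => ∫ σ, F σ ∂μ)
    (E₂ := fun F => ∫ σ, F σ ∂ν) hR hlip0 hlips hosc hC0 hCs hT hdust h₁le h₁ge h₁T h₂le
    h₂ge h₂T hc0 hc1 hrow hF hδ'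


open scoped Classical in
/-- **Dobrushin's uniqueness theorem in the total-variation form, infinite range**
(Friedli–Velenik 2017, Thm. 6.31 as printed: `c(π) = sup_i ∑_j c_{ij}(π) < 1` with the TV
coefficients `c_{ij}(π)`, the sum over ALL sites `j`; Föllmer 1988, Ch. I, (2.1)/(2.7)/(2.9);
Georgii 2011, Thm. 8.7): the discrete weight `r(a, b) = 𝟙[a ≠ b]` turns the Kantorovich–Rubinstein
bound into the total-variation one — `|∫ φ dγ_x(·|ω) - ∫ φ dγ_x(·|η)| ≤ L ∑' y, C x y 𝟙[ω y ≠ η y]`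
for every measurable `φ` of oscillation `≤ L` — and for a spin space carrying a BOUNDED
pseudo-metric generating its σ-algebra (e.g. a finite or compact metric spin space) the discrete
weight dominates the metric, so `subsingleton_gibbsMeasures_of_summable` applies: at most one Gibbs
measure. [cite: FriedliVelenik2017, Thm. 6.31] -/
theorem subsingleton_gibbsMeasures_of_summable_tv [PseudoMetricSpace S] [BorelSpace S]
    [Nonempty S] (hγ : IsSpecification γ) {A : ℝ} (hA0 : 0 ≤ A) (hA : ∀ a b : S, dist a b ≤ A)
    (hC0 : ∀ x y, 0 ≤ C x y) (hCs : ∀ x, Summable (C x))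
    (hcontr : ∀ (x : V) (ω η : V → S) (φ : S → ℝ) (L : ℝ), Measurable φ →
      (∃ M, ∀ s, |φ s| ≤ M) → 0 ≤ L → (∀ a b, |φ a - φ b| ≤ L) →
      |∫ s, φ s ∂(siteLaw γ x ω) - ∫ s, φ s ∂(siteLaw γ x η)| ≤
        L * ∑' y, C x y * (if ω y = η y then 0 else 1))
    {c : ℝ} (hc0 : 0 ≤ c) (hc1 : c < 1) (hrow : ∀ x, ∑' y, C x y ≤ c) :
    (gibbsMeasures γ).Subsingleton := by
  -- the discrete weight
  refine subsingleton_gibbsMeasures_of_summable (r := fun a b : S => if a = b then (0 : ℝ) else 1)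
    (M := S) hγ (R := 1) (fun a b => by split_ifs <;> norm_num)
    (fun a b => by split_ifs <;> norm_num) (fun a => by simp) hC0 hCs
    (fun x ω η φ L hφm hφb hL hφ => ?_) hc0 hc1 hrow id
    (by rw [MeasurableSpace.comap_id]) hA0 (fun a b => ?_)
  · -- a function of oscillation `≤ L` is `L`-Lipschitz for the discrete weight, and conversely
    have hφ' : ∀ a b, |φ a - φ b| ≤ L := fun a b => by
      have h := hφ a b
      by_cases hab : a = b
      · subst hab; simp [hL]
      · simpa [hab] using h
    exact hcontr x ω η φ L hφm hφb hL hφ'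
  · by_cases hab : a = b
    · subst hab; simp
    · rw [if_neg hab, mul_one]; exact hA a b

end Determine

/-! ### Covariance decay -/

/-- **Covariance estimate in Dobrushin's regime under the weighted row-sum condition, infinite
range with summable rows, Vasserstein form** (Föllmer 1988, Ch. I, Thm. (2.13)/(2.23) with Cor.
(2.14)/(2.24); Georgii 2011, Remark 8.26 and §8.2; Künsch 1982): let the one-site laws of `γ`
satisfy the global Kantorovich–Rubinstein bound with summable rows (as in
`subsingleton_gibbsMeasures_of_summable`), let `μ` be a Gibbs measure and `f, g` bounded
measurable local observables with coordinatewise Lipschitz bounds `δ_f, δ_g` and dependence sets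
`Δ_f, Δ_g`. If off `Δ_g` the rows are `≤ c < 1` and a weight `0 ≤ θ ≤ 1`, `= 1` on `Δ_g`,
satisfies `∑' y, C x y θ y ≤ c θ x`, then
`|cov_μ(f, g)| ≤ 2 R² (∑_{y ∈ Δ_g} δ_g y) ∑_{y ∈ Δ_f} θ y δ_f y` (tilt trick: `μ` versus
`g̃ μ / μ(g̃)`, `g̃ = g - g(τ₀) + R ∑ δ_g ≥ 0`, an invariant state off `Δ_g`).
[cite: Follmer1988, Ch. I Theorem (2.13)] -/
theorem abs_covariance_le_of_summable_weighted [DecidableEq V] (hγ : IsSpecification γ)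
    {R : ℝ} (hr0 : ∀ a b, 0 ≤ r a b) (hrR : ∀ a b, r a b ≤ R) (hR : 0 ≤ R)
    (hr00 : ∀ a, r a a = 0) (hC0 : ∀ x y, 0 ≤ C x y) (hCs : ∀ x, Summable (C x))
    (hcontr : ∀ (x : V) (ω η : V → S) (φ : S → ℝ) (L : ℝ), Measurable φ →
      (∃ M, ∀ s, |φ s| ≤ M) → 0 ≤ L → (∀ a b, |φ a - φ b| ≤ L * r a b) →
      |∫ s, φ s ∂(siteLaw γ x ω) - ∫ s, φ s ∂(siteLaw γ x η)| ≤
        L * ∑' y, C x y * r (ω y) (η y))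
    {μ : Measure (V → S)} (hμ : IsGibbsMeasure γ μ) {f g : (V → S) → ℝ}
    (hfm : Measurable f) {Δf : Finset V} (hfdep : DependsOn f (↑Δf : Set V)) {Mf : ℝ}
    (hMf : ∀ σ, |f σ| ≤ Mf) {δf : V → ℝ} (hδf : IsLipBound r f δf) (hgm : Measurable g)
    {Δg : Finset V} (hgdep : DependsOn g (↑Δg : Set V)) {Mg : ℝ} (hMg : ∀ σ, |g σ| ≤ Mg)
    {δg : V → ℝ} (hδg : IsLipBound r g δg) {c : ℝ} (hc0 : 0 ≤ c) (hc1 : c < 1)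
    (hrow : ∀ x ∉ Δg, ∑' y, C x y ≤ c) {θ : V → ℝ} (hθ0 : ∀ y, 0 ≤ θ y) (hθ1 : ∀ y, θ y ≤ 1)
    (hθg : ∀ y ∈ Δg, θ y = 1) (hroww : ∀ x ∉ Δg, ∑' y, C x y * θ y ≤ c * θ x) :
    |cov[f, g; μ]| ≤ 2 * R ^ 2 * (∑ y ∈ Δg, δg y) * ∑ y ∈ Δf, θ y * δf y := by
  classical
  haveI := hμ.isProbabilityMeasure
  obtain ⟨τ₀, -⟩ := nonempty_of_measure_ne_zero (μ := μ) (s := Set.univ) (by simp)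
  -- the shifted density `g̃ ∈ [0, 2 S_g]`
  set Sg : ℝ := R * ∑ y ∈ Δg, δg y with hSg
  have hSg0 : 0 ≤ Sg := mul_nonneg hR (Finset.sum_nonneg fun y _ => hδg.nonneg y)
  set gt : (V → S) → ℝ := fun σ => g σ + (Sg - g τ₀) with hgt
  have hosc' : ∀ σ, |g σ - g τ₀| ≤ Sg := fun σ =>
    abs_sub_le_mul_sum_of_dependsOn hrR hgdep hδg σ τ₀
  have hgt0 : ∀ σ, 0 ≤ gt σ := fun σ => by
    have := (abs_le.1 (hosc' σ)).1; simp only [hgt]; linarith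
  have hgtB : ∀ σ, gt σ ≤ 2 * Sg := fun σ => by
    have := (abs_le.1 (hosc' σ)).2; simp only [hgt]; linarith
  have hgtm : Measurable gt := hgm.add_const _
  have hgtdep : DependsOn gt (↑Δg : Set V) := fun σ τ h => by
    simp only [hgt]; rw [hgdep h]
  have hgi : Integrable g μ := integrable_of_abs_le' hgm hMg
  have hfi : Integrable f μ := integrable_of_abs_le' hfm hMf
  have hgtabs : ∀ σ, |gt σ| ≤ 2 * Sg := fun σ => by
    rw [abs_of_nonneg (hgt0 σ)]; exact hgtB σ
  have hgti : Integrable gt μ := integrable_of_abs_le' hgtm hgtabs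
  -- the right-hand side is nonnegative
  have hRHS : 0 ≤ 2 * R ^ 2 * (∑ y ∈ Δg, δg y) * ∑ y ∈ Δf, θ y * δf y := by
    have h1 : 0 ≤ ∑ y ∈ Δg, δg y := Finset.sum_nonneg fun y _ => hδg.nonneg y
    have h2 : 0 ≤ ∑ y ∈ Δf, θ y * δf y :=
      Finset.sum_nonneg fun y _ => mul_nonneg (hθ0 y) (hδf.nonneg y)
    positivity
  -- `cov(f, g) = cov(f, g̃) = μ(f g̃) - μ(f) μ(g̃)`
  have hcov : cov[f, g; μ] = ∫ σ, f σ * gt σ ∂μ - (∫ σ, f σ ∂μ) * ∫ σ, gt σ ∂μ := by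
    have h1 : cov[f, g; μ] = cov[f, gt; μ] := by
      rw [hgt, covariance_add_const_right hgi]
    rw [h1, covariance_eq_sub]
    · rfl
    · exact memLp_of_bounded (a := -Mf) (b := Mf)
        (ae_of_all _ fun σ => abs_le.1 (hMf σ)) hfm.aestronglyMeasurable 2
    · exact memLp_of_bounded (a := -(2 * Sg)) (b := 2 * Sg)
        (ae_of_all _ fun σ => abs_le.1 (hgtabs σ)) hgtm.aestronglyMeasurable 2
  by_cases hz : ∫ σ, gt σ ∂μ = 0
  · -- degenerate case: `g̃ = 0` a.e., so the covariance vanishes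
    have hae : gt =ᵐ[μ] 0 := (integral_eq_zero_iff_of_nonneg (fun σ => hgt0 σ) hgti).1 hz
    have hfg : ∫ σ, f σ * gt σ ∂μ = 0 := by
      rw [← integral_zero (α := V → S) (μ := μ) (G := ℝ)]
      refine integral_congr_ae ?_
      filter_upwards [hae] with σ hσ
      simp [hσ]
    rw [hcov, hfg, hz, mul_zero, sub_zero, abs_zero]
    exact hRHS
  have hpos : 0 < ∫ σ, gt σ ∂μ :=
    lt_of_le_of_ne (integral_nonneg hgt0) (Ne.symm hz)
  -- the abstract layer: predicates, states
  set Adm : ((V → S) → ℝ) → Prop := fun F => Measurable F ∧ ∃ M, ∀ σ, |F σ| ≤ M with hAdmdef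
  set Lip : ((V → S) → ℝ) → (V → ℝ) → Prop := fun F δ =>
    (∀ y, 0 ≤ δ y) ∧ Summable δ ∧ ∀ σ τ, |F σ - F τ| ≤ ∑' y, δ y * r (σ y) (τ y) with hLipdef
  have hAdm : ∀ F, Adm F ↔ (Measurable F ∧ ∃ M, ∀ σ, |F σ| ≤ M) := fun F => Iff.rfl
  have hLip : ∀ F δ, Lip F δ ↔
      ((∀ y, 0 ≤ δ y) ∧ Summable δ ∧ ∀ σ τ, |F σ - F τ| ≤ ∑' y, δ y * r (σ y) (τ y)) :=
    fun F δ => Iff.rfl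
  obtain ⟨hlip0, hlips, hosc, hT, hdust⟩ :=
    layer_hyps hγ hr0 hrR hr00 hC0 hCs hcontr hAdm hLip
  obtain ⟨h₁le, h₁ge, h₁T⟩ := state_gibbs hγ hAdm hμ
  obtain ⟨h₂le, h₂ge, h₂T⟩ := state_tilt hγ hAdm hμ hgtm hgtdep hgt0 hgtB hpos
  -- `f` is admissible with the global Lipschitz vector `δ_f 𝟙_{Δ_f}`
  have hF : Adm f := ⟨hfm, Mf, hMf⟩
  have hδ' : Lip f fun y => if y ∈ Δf then δf y else 0 := by
    refine ⟨fun y => ?_, summable_of_ne_finset_zero (s := Δf) fun y hy => if_neg hy,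
      fun σ τ => abs_sub_le_tsum_of_dependsOn hfdep hδf σ τ⟩
    dsimp only
    split_ifs
    · exact hδf.nonneg y
    · exact le_rfl
  have hW : ∀ x, x ∈ ((↑Δg : Set V)ᶜ) → x ∉ Δg := fun x hx h' =>
    (Set.mem_compl_iff _ _).1 hx (Finset.mem_coe.2 h')
  have key := abs_sub_le_tsum_weighted (W := ((↑Δg : Set V)ᶜ)) (T := fun x F => siteAvg γ x F)
    (E₁ := fun F => ∫ σ, F σ ∂μ) (E₂ := fun F => (∫ σ, gt σ * F σ ∂μ) / ∫ σ, gt σ ∂μ)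
    hR hlip0 hlips hosc hC0 hCs hT hdust h₁le h₁ge (fun F x _ hF => h₁T x hF) h₂le h₂ge h₂T
    hc0 hc1 (fun x hx => hrow x (hW x hx)) (θ := θ) hθ0 hθ1
    (fun y hy => hθg y (by simpa using hy)) (fun x hx => hroww x (hW x hx)) hF hδ'
  -- unfold the conclusion of `key`
  have hsum : (∑' y, θ y * (if y ∈ Δf then δf y else 0)) = ∑ y ∈ Δf, θ y * δf y := by
    rw [tsum_eq_sum (s := Δf) (fun y hy => by rw [if_neg hy, mul_zero])]
    exact Finset.sum_congr rfl fun y hy => by rw [if_pos hy]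
  have key' : |∫ σ, f σ ∂μ - (∫ σ, gt σ * f σ ∂μ) / ∫ σ, gt σ ∂μ| ≤
      R * ∑ y ∈ Δf, θ y * δf y := by
    rw [← hsum]; exact key
  -- `cov = μ(g̃) · (μ_{g̃}(f) - μ(f))`
  have hfgt : ∫ σ, f σ * gt σ ∂μ = ∫ σ, gt σ * f σ ∂μ :=
    integral_congr_ae (ae_of_all _ fun σ => mul_comm _ _)
  have hident : cov[f, g; μ] =
      (∫ σ, gt σ ∂μ) * ((∫ σ, gt σ * f σ ∂μ) / ∫ σ, gt σ ∂μ - ∫ σ, f σ ∂μ) := by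
    rw [hcov, hfgt, mul_sub, mul_div_cancel₀ _ hz]
    ring
  rw [hident, abs_mul, abs_of_pos hpos, abs_sub_comm]
  have hgtint : ∫ σ, gt σ ∂μ ≤ 2 * Sg := by
    calc ∫ σ, gt σ ∂μ ≤ ∫ _σ, 2 * Sg ∂μ := integral_mono hgti (integrable_const _) hgtB
      _ = 2 * Sg := by simp
  calc (∫ σ, gt σ ∂μ) * |∫ σ, f σ ∂μ - (∫ σ, gt σ * f σ ∂μ) / ∫ σ, gt σ ∂μ|
      ≤ (2 * Sg) * (R * ∑ y ∈ Δf, θ y * δf y) :=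
        mul_le_mul hgtint key' (abs_nonneg _) (by positivity)
    _ = 2 * R ^ 2 * (∑ y ∈ Δg, δg y) * ∑ y ∈ Δf, θ y * δf y := by
        rw [hSg]; ring

/-- **Exponential decay of covariances under the weighted Dobrushin condition, infinite range
with summable rows, Vasserstein form** (Föllmer 1988, Ch. I, (2.23)–(2.24): "exponential decay
of correlation follows as in (2.14): if `κ̄ < 1` …", `κ̄ = sup_k ∑_i e^{d(i,k)} C_{ik}`; Georgii 2011,
Remark 8.26; Künsch 1982): with `d ≥ 0`, `t ≥ 0`, the WEIGHTED ROWS `y ↦ C x y e^{t d x y}`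
summable with sum `≤ c < 1` off `Δ_g`, and a profile `ρ ≥ 0` vanishing on `Δ_g` with
`ρ x ≤ ρ y + d x y` (`x ∉ Δ_g`; e.g. the `d`-distance to `Δ_g`):
`|cov_μ(f, g)| ≤ 2 R² (∑_{y ∈ Δ_g} δ_g y) ∑_{y ∈ Δ_f} e^{-t ρ y} δ_f y`. No finite set of neighbours
is assumed: the rate `t` comes from the weight. [cite: Follmer1988, Ch. I Corollary (2.14)] -/
theorem abs_covariance_le_of_summable_exp_profile [DecidableEq V] (hγ : IsSpecification γ)
    {R : ℝ} (hr0 : ∀ a b, 0 ≤ r a b) (hrR : ∀ a b, r a b ≤ R) (hR : 0 ≤ R)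
    (hr00 : ∀ a, r a a = 0) (hC0 : ∀ x y, 0 ≤ C x y) (hCs : ∀ x, Summable (C x))
    (hcontr : ∀ (x : V) (ω η : V → S) (φ : S → ℝ) (L : ℝ), Measurable φ →
      (∃ M, ∀ s, |φ s| ≤ M) → 0 ≤ L → (∀ a b, |φ a - φ b| ≤ L * r a b) →
      |∫ s, φ s ∂(siteLaw γ x ω) - ∫ s, φ s ∂(siteLaw γ x η)| ≤
        L * ∑' y, C x y * r (ω y) (η y))
    {μ : Measure (V → S)} (hμ : IsGibbsMeasure γ μ) {f g : (V → S) → ℝ}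
    (hfm : Measurable f) {Δf : Finset V} (hfdep : DependsOn f (↑Δf : Set V)) {Mf : ℝ}
    (hMf : ∀ σ, |f σ| ≤ Mf) {δf : V → ℝ} (hδf : IsLipBound r f δf) (hgm : Measurable g)
    {Δg : Finset V} (hgdep : DependsOn g (↑Δg : Set V)) {Mg : ℝ} (hMg : ∀ σ, |g σ| ≤ Mg)
    {δg : V → ℝ} (hδg : IsLipBound r g δg) {c : ℝ} (hc0 : 0 ≤ c) (hc1 : c < 1)
    (d : V → V → ℝ) (hd : ∀ x y, 0 ≤ d x y) {t : ℝ} (ht : 0 ≤ t)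
    (hsw : ∀ x ∉ Δg, Summable fun y => C x y * Real.exp (t * d x y))
    (hroww : ∀ x ∉ Δg, ∑' y, C x y * Real.exp (t * d x y) ≤ c)
    (ρ : V → ℝ) (hρ0 : ∀ y, 0 ≤ ρ y) (hρg : ∀ y ∈ Δg, ρ y = 0)
    (hρ : ∀ x ∉ Δg, ∀ y, ρ x ≤ ρ y + d x y) :
    |cov[f, g; μ]| ≤
      2 * R ^ 2 * (∑ y ∈ Δg, δg y) * ∑ y ∈ Δf, Real.exp (-(t * ρ y)) * δf y := by
  -- the weight `θ = e^{-t ρ}`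
  have hθ0 : ∀ y, 0 ≤ Real.exp (-(t * ρ y)) := fun y => (Real.exp_pos _).le
  have hθ1 : ∀ y, Real.exp (-(t * ρ y)) ≤ 1 := fun y =>
    Real.exp_le_one_iff.2 (by nlinarith [hρ0 y])
  have hθg : ∀ y ∈ Δg, Real.exp (-(t * ρ y)) = 1 := fun y hy => by rw [hρg y hy]; simp
  -- summable rows `C x ·` and `C x · θ`
  have hsθ : ∀ x, Summable fun y => C x y * Real.exp (-(t * ρ y)) := fun x =>
    Summable.of_nonneg_of_le (fun y => mul_nonneg (hC0 x y) (hθ0 y))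
      (fun y => by simpa using mul_le_mul_of_nonneg_left (hθ1 y) (hC0 x y)) (hCs x)
  -- plain rows from the weighted rows (`e^{t d} ≥ 1`)
  have hrow : ∀ x ∉ Δg, ∑' y, C x y ≤ c := fun x hx => by
    refine le_trans ((hCs x).tsum_le_tsum (fun y => ?_) (hsw x hx)) (hroww x hx)
    have h1 : (1 : ℝ) ≤ Real.exp (t * d x y) := Real.one_le_exp (mul_nonneg ht (hd x y))
    simpa using mul_le_mul_of_nonneg_left h1 (hC0 x y)
  refine abs_covariance_le_of_summable_weighted hγ hr0 hrR hR hr00 hC0 hCs hcontr hμ hfm hfdep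
    hMf hδf hgm hgdep hMg hδg hc0 hc1 hrow hθ0 hθ1 hθg (fun x hx => ?_)
  calc ∑' y, C x y * Real.exp (-(t * ρ y))
      ≤ ∑' y, C x y * Real.exp (t * d x y) * Real.exp (-(t * ρ x)) := by
        refine (hsθ x).tsum_le_tsum (fun y => ?_) ((hsw x hx).mul_right _)
        rw [mul_assoc, ← Real.exp_add]
        refine mul_le_mul_of_nonneg_left (Real.exp_le_exp.2 ?_) (hC0 x y)
        nlinarith [hρ x hx y]
    _ = (∑' y, C x y * Real.exp (t * d x y)) * Real.exp (-(t * ρ x)) := tsum_mul_right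
    _ ≤ c * Real.exp (-(t * ρ x)) :=
        mul_le_mul_of_nonneg_right (hroww x hx) (Real.exp_pos _).le

/-- **Exponential clustering at distance `m`, infinite range with summable rows** (Föllmer 1988,
Ch. I, (2.24); Künsch 1982; Georgii 2011, Remark 8.26): under the hypotheses of
`abs_covariance_le_of_summable_exp_profile`, if `ρ ≥ m` on `Δ_f` then
`|cov_μ(f, g)| ≤ 2 R² (∑_{Δ_g} δ_g) (∑_{Δ_f} δ_f) e^{-t m}` — uniform in the index set `V` as soon
as the weighted row-sum constant `c` is. [cite: Follmer1988, Ch. I Corollary (2.14)] -/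
theorem abs_covariance_le_of_summable_exp_dist [DecidableEq V] (hγ : IsSpecification γ)
    {R : ℝ} (hr0 : ∀ a b, 0 ≤ r a b) (hrR : ∀ a b, r a b ≤ R) (hR : 0 ≤ R)
    (hr00 : ∀ a, r a a = 0) (hC0 : ∀ x y, 0 ≤ C x y) (hCs : ∀ x, Summable (C x))
    (hcontr : ∀ (x : V) (ω η : V → S) (φ : S → ℝ) (L : ℝ), Measurable φ →
      (∃ M, ∀ s, |φ s| ≤ M) → 0 ≤ L → (∀ a b, |φ a - φ b| ≤ L * r a b) →
      |∫ s, φ s ∂(siteLaw γ x ω) - ∫ s, φ s ∂(siteLaw γ x η)| ≤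
        L * ∑' y, C x y * r (ω y) (η y))
    {μ : Measure (V → S)} (hμ : IsGibbsMeasure γ μ) {f g : (V → S) → ℝ}
    (hfm : Measurable f) {Δf : Finset V} (hfdep : DependsOn f (↑Δf : Set V)) {Mf : ℝ}
    (hMf : ∀ σ, |f σ| ≤ Mf) {δf : V → ℝ} (hδf : IsLipBound r f δf) (hgm : Measurable g)
    {Δg : Finset V} (hgdep : DependsOn g (↑Δg : Set V)) {Mg : ℝ} (hMg : ∀ σ, |g σ| ≤ Mg)
    {δg : V → ℝ} (hδg : IsLipBound r g δg) {c : ℝ} (hc0 : 0 ≤ c) (hc1 : c < 1)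
    (d : V → V → ℝ) (hd : ∀ x y, 0 ≤ d x y) {t : ℝ} (ht : 0 ≤ t)
    (hsw : ∀ x ∉ Δg, Summable fun y => C x y * Real.exp (t * d x y))
    (hroww : ∀ x ∉ Δg, ∑' y, C x y * Real.exp (t * d x y) ≤ c)
    (ρ : V → ℝ) (hρ0 : ∀ y, 0 ≤ ρ y) (hρg : ∀ y ∈ Δg, ρ y = 0)
    (hρ : ∀ x ∉ Δg, ∀ y, ρ x ≤ ρ y + d x y) {m : ℝ} (hm : ∀ y ∈ Δf, m ≤ ρ y) :
    |cov[f, g; μ]| ≤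
      2 * R ^ 2 * (∑ y ∈ Δg, δg y) * (∑ y ∈ Δf, δf y) * Real.exp (-(t * m)) := by
  refine (abs_covariance_le_of_summable_exp_profile hγ hr0 hrR hR hr00 hC0 hCs hcontr hμ hfm
    hfdep hMf hδf hgm hgdep hMg hδg hc0 hc1 d hd ht hsw hroww ρ hρ0 hρg hρ).trans ?_
  have h1 : ∑ y ∈ Δf, Real.exp (-(t * ρ y)) * δf y ≤ ∑ y ∈ Δf, Real.exp (-(t * m)) * δf y :=
    Finset.sum_le_sum fun y hy => mul_le_mul_of_nonneg_right
      (Real.exp_le_exp.2 (by nlinarith [hm y hy])) (hδf.nonneg y)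
  have h2 : 0 ≤ 2 * R ^ 2 * ∑ y ∈ Δg, δg y := by
    have : 0 ≤ ∑ y ∈ Δg, δg y := Finset.sum_nonneg fun y _ => hδg.nonneg y
    positivity
  calc 2 * R ^ 2 * (∑ y ∈ Δg, δg y) * ∑ y ∈ Δf, Real.exp (-(t * ρ y)) * δf y
      ≤ 2 * R ^ 2 * (∑ y ∈ Δg, δg y) * ∑ y ∈ Δf, Real.exp (-(t * m)) * δf y :=
        mul_le_mul_of_nonneg_left h1 h2
    _ = 2 * R ^ 2 * (∑ y ∈ Δg, δg y) * (∑ y ∈ Δf, δf y) * Real.exp (-(t * m)) := by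
        rw [← Finset.mul_sum]; ring

/-! ### From sitewise coefficients and quasilocality to the global bound -/

/-- **From the sitewise Vasserstein condition and quasilocality to the global summable bound**
(Föllmer 1988, Ch. I, (2.20) with the continuity requirement (2.4): the sitewise coefficients
`C_{ik}` control the one-site law under a change of the boundary condition at ONE site; if moreover
the one-site law is continuous in the boundary condition "at infinity", uniformly on bounded
Lipschitz test functions, the changes may be accumulated over all sites): if for every site `y`
and `ω = η` off `y`, `|∫ φ dγ_x(·|ω) - ∫ φ dγ_x(·|η)| ≤ C x y · L · r(ω y, η y)`, the row `C x ·` is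
summable, `0 ≤ r ≤ R`, and for every `ε > 0` there is a finite `Λ` such that boundary conditions
agreeing on `Λ` have one-site laws at `x` within `ε L` on every bounded measurable `L`-Lipschitz `φ`,
then `|∫ φ dγ_x(·|ω) - ∫ φ dγ_x(·|η)| ≤ L ∑' y, C x y · r(ω y, η y)` for ALL `ω, η`.
[cite: Follmer1988, Ch. I (2.20)] -/
theorem global_of_sitewise_of_quasilocal [DecidableEq V] {R : ℝ}
    (hr0 : ∀ a b, 0 ≤ r a b) (hrR : ∀ a b, r a b ≤ R) (hC0 : ∀ x y, 0 ≤ C x y)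
    (hCs : ∀ x, Summable (C x)) (x : V)
    (hsite : ∀ (y : V) (ω η : V → S), (∀ z, z ≠ y → ω z = η z) →
      ∀ (φ : S → ℝ) (L : ℝ), Measurable φ → (∃ M, ∀ s, |φ s| ≤ M) → 0 ≤ L →
        (∀ a b, |φ a - φ b| ≤ L * r a b) →
        |∫ s, φ s ∂(siteLaw γ x ω) - ∫ s, φ s ∂(siteLaw γ x η)| ≤ C x y * L * r (ω y) (η y))
    (hql : ∀ (M L ε : ℝ), 0 < ε → ∃ Λ : Finset V, ∀ (ω η : V → S), (∀ z ∈ Λ, ω z = η z) →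
      ∀ (φ : S → ℝ), Measurable φ → (∀ s, |φ s| ≤ M) → (∀ a b, |φ a - φ b| ≤ L * r a b) →
        |∫ s, φ s ∂(siteLaw γ x ω) - ∫ s, φ s ∂(siteLaw γ x η)| ≤ ε)
    (ω η : V → S) (φ : S → ℝ) (L : ℝ) (hφm : Measurable φ) (hφb : ∃ M, ∀ s, |φ s| ≤ M)
    (hL : 0 ≤ L) (hφ : ∀ a b, |φ a - φ b| ≤ L * r a b) :
    |∫ s, φ s ∂(siteLaw γ x ω) - ∫ s, φ s ∂(siteLaw γ x η)| ≤
      L * ∑' y, C x y * r (ω y) (η y) := by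
  obtain ⟨M, hM⟩ := hφb
  -- summable majorant
  have hs : Summable fun y => C x y * r (ω y) (η y) :=
    Summable.of_nonneg_of_le (fun y => mul_nonneg (hC0 x y) (hr0 _ _))
      (fun y => mul_le_mul_of_nonneg_left (hrR _ _) (hC0 x y)) ((hCs x).mul_right R)
  -- it suffices to prove the bound up to every `ε > 0`
  refine le_of_forall_pos_le_add fun ε hε => ?_
  obtain ⟨Λ, hΛ⟩ := hql M L ε hε
  -- `ω_Λ`: `ω` on `Λ`, `η` off `Λ`
  set ωΛ : V → S := Λ.piecewise ω η with hωΛ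
  have h1 : |∫ s, φ s ∂(siteLaw γ x ω) - ∫ s, φ s ∂(siteLaw γ x ωΛ)| ≤ ε :=
    hΛ ω ωΛ (fun z hz => (Finset.piecewise_eq_of_mem _ _ _ hz).symm) φ hφm hM hφ
  -- telescope over `Λ`
  have h2 : ∀ s : Finset V, s ⊆ Λ →
      |∫ a, φ a ∂(siteLaw γ x (s.piecewise ω η)) - ∫ a, φ a ∂(siteLaw γ x η)| ≤
        L * ∑ y ∈ s, C x y * r (ω y) (η y) := by
    intro s
    induction s using Finset.induction_on with
    | empty => intro _; simp
    | insert y s hys ih =>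
      intro hsub
      have hs' : s ⊆ Λ := fun z hz => hsub (Finset.mem_insert_of_mem hz)
      have hstep : |∫ a, φ a ∂(siteLaw γ x ((insert y s).piecewise ω η)) -
          ∫ a, φ a ∂(siteLaw γ x (s.piecewise ω η))| ≤ C x y * L * r (ω y) (η y) := by
        have h := hsite y ((insert y s).piecewise ω η) (s.piecewise ω η)
          (fun z hz => by rw [Finset.piecewise_insert_of_ne _ _ _ hz]) φ L hφm ⟨M, hM⟩ hL hφ
        rwa [Finset.piecewise_eq_of_mem _ _ _ (Finset.mem_insert_self y s),
          Finset.piecewise_eq_of_notMem _ _ _ hys] at h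
      rw [Finset.sum_insert hys]
      calc |∫ a, φ a ∂(siteLaw γ x ((insert y s).piecewise ω η)) - ∫ a, φ a ∂(siteLaw γ x η)|
          ≤ |∫ a, φ a ∂(siteLaw γ x ((insert y s).piecewise ω η)) -
              ∫ a, φ a ∂(siteLaw γ x (s.piecewise ω η))| +
            |∫ a, φ a ∂(siteLaw γ x (s.piecewise ω η)) - ∫ a, φ a ∂(siteLaw γ x η)| :=
            abs_sub_le _ _ _
        _ ≤ C x y * L * r (ω y) (η y) + L * ∑ z ∈ s, C x z * r (ω z) (η z) :=
            add_le_add hstep (ih hs')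
        _ = L * (C x y * r (ω y) (η y) + ∑ z ∈ s, C x z * r (ω z) (η z)) := by ring
  have h3 : L * ∑ y ∈ Λ, C x y * r (ω y) (η y) ≤ L * ∑' y, C x y * r (ω y) (η y) :=
    mul_le_mul_of_nonneg_left
      (hs.sum_le_tsum Λ fun y _ => mul_nonneg (hC0 x y) (hr0 _ _)) hL
  calc |∫ s, φ s ∂(siteLaw γ x ω) - ∫ s, φ s ∂(siteLaw γ x η)|
      ≤ |∫ s, φ s ∂(siteLaw γ x ω) - ∫ s, φ s ∂(siteLaw γ x ωΛ)| +
          |∫ s, φ s ∂(siteLaw γ x ωΛ) - ∫ s, φ s ∂(siteLaw γ x η)| := abs_sub_le _ _ _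
    _ ≤ ε + L * ∑ y ∈ Λ, C x y * r (ω y) (η y) := add_le_add h1 (h2 Λ le_rfl)
    _ ≤ L * ∑' y, C x y * r (ω y) (η y) + ε := by linarith

/-! ### The finite-range condition is a special case -/

/-- **The finite-range Dobrushin condition `IsKRContraction` implies the global summable form**
used in this file, with the (finitely supported) coefficients `C x y 𝟙[y ∈ nbr x]`: change the
boundary condition on `nbr x` one site at a time (Föllmer 1988, Ch. I, (2.20): the sitewise
Vasserstein coefficients; the law at `x` reads only `nbr x`). So the theorems of this file contain
those of `DobrushinMetricStates.lean`. [cite: Follmer1988, Ch. I (2.20)] -/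
theorem IsKRContraction.global [DecidableEq V] {nbr : V → Finset V}
    (hC : IsKRContraction γ r nbr C) (x : V) (ω η : V → S)
    (φ : S → ℝ) (L : ℝ) (hφm : Measurable φ) (hφb : ∃ M, ∀ s, |φ s| ≤ M) (hL : 0 ≤ L)
    (hφ : ∀ a b, |φ a - φ b| ≤ L * r a b) :
    |∫ s, φ s ∂(siteLaw γ x ω) - ∫ s, φ s ∂(siteLaw γ x η)| ≤
      L * ∑' y, (if y ∈ nbr x then C x y else 0) * r (ω y) (η y) := by
  rw [tsum_eq_sum (s := nbr x) (fun y hy => by rw [if_neg hy, zero_mul])]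
  -- telescope over the sites of `nbr x`, starting from `η` and switching to `ω` one at a time
  suffices h : ∀ s : Finset V, s ⊆ nbr x →
      |∫ a, φ a ∂(siteLaw γ x (s.piecewise ω η)) - ∫ a, φ a ∂(siteLaw γ x η)| ≤
        L * ∑ y ∈ s, (if y ∈ nbr x then C x y else 0) * r (ω y) (η y) by
    have hlaw : siteLaw γ x ω = siteLaw γ x ((nbr x).piecewise ω η) :=
      hC.siteLaw_congr x ω _ fun z hz => (Finset.piecewise_eq_of_mem _ _ _ hz).symm
    rw [hlaw]
    exact h (nbr x) le_rfl
  intro s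
  induction s using Finset.induction_on with
  | empty =>
    intro _
    simp
  | insert y s hys ih =>
    intro hsub
    have hy : y ∈ nbr x := hsub (Finset.mem_insert_self y s)
    have hs : s ⊆ nbr x := fun z hz => hsub (Finset.mem_insert_of_mem hz)
    -- one step: change the site `y`
    have hstep : |∫ a, φ a ∂(siteLaw γ x ((insert y s).piecewise ω η)) -
        ∫ a, φ a ∂(siteLaw γ x (s.piecewise ω η))| ≤ C x y * L * r (ω y) (η y) := by
      have h := hC.contract x y hy ((insert y s).piecewise ω η) (s.piecewise ω η)
        (fun z hz => by rw [Finset.piecewise_insert_of_ne _ _ _ hz]) φ L hφm hφb hL hφ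
      rwa [Finset.piecewise_eq_of_mem _ _ _ (Finset.mem_insert_self y s),
        Finset.piecewise_eq_of_notMem _ _ _ hys] at h
    rw [Finset.sum_insert hys, if_pos hy]
    calc |∫ a, φ a ∂(siteLaw γ x ((insert y s).piecewise ω η)) - ∫ a, φ a ∂(siteLaw γ x η)|
        ≤ |∫ a, φ a ∂(siteLaw γ x ((insert y s).piecewise ω η)) -
            ∫ a, φ a ∂(siteLaw γ x (s.piecewise ω η))| +
          |∫ a, φ a ∂(siteLaw γ x (s.piecewise ω η)) - ∫ a, φ a ∂(siteLaw γ x η)| :=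
          abs_sub_le _ _ _
      _ ≤ C x y * L * r (ω y) (η y) +
          L * ∑ z ∈ s, (if z ∈ nbr x then C x z else 0) * r (ω z) (η z) :=
          add_le_add hstep (ih hs)
      _ = L * (C x y * r (ω y) (η y) +
          ∑ z ∈ s, (if z ∈ nbr x then C x z else 0) * r (ω z) (η z)) := by ring

/-- The finitely supported coefficients `C x y 𝟙[y ∈ nbr x]` of a finite-range `IsKRContraction`
are nonnegative with summable rows `∑' = ∑_{y ∈ nbr x} C x y` (Föllmer 1988, Ch. I, (2.7)).
[cite: Follmer1988, Ch. I (2.7)] -/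
theorem IsKRContraction.summable_indicator [DecidableEq V] {nbr : V → Finset V}
    (hC : IsKRContraction γ r nbr C) (x : V) :
    (∀ y, 0 ≤ (if y ∈ nbr x then C x y else 0)) ∧
    (Summable fun y => if y ∈ nbr x then C x y else 0) ∧
    (∑' y, (if y ∈ nbr x then C x y else 0)) = ∑ y ∈ nbr x, C x y := by
  refine ⟨fun y => ?_, summable_of_ne_finset_zero (s := nbr x) fun y hy => if_neg hy, ?_⟩
  · split_ifs
    · exact hC.nonneg x y
    · exact le_rfl
  · rw [tsum_eq_sum (s := nbr x) (fun y hy => if_neg hy)]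
    exact Finset.sum_congr rfl fun y hy => if_pos hy

end States

end DobrushinMetric

end Literature.Probability.LatticeModels
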